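import Summits.Langlands.Langlands.Theses.RegularAvatarReduction
import Summits.Langlands.Langlands.Theorems.LevelOneDyadicRegular
import Literature.NumberTheory.Automorphic.CompletedCohomologyHeckeAlgebraGLn
import Literature.NumberTheory.GaloisRepresentations.StableLatticeValuationRing

/-!
# TorsionAvatarReduction — «the minimal counterexample to regular non-Artin-residue automorphy either HAS A TORSION AVATAR — and then the problem is to LIFT a mod-2 torsion eigenclass to a cusp form — or is 2-ADICALLY DARK» (decomp-langlands, lens 4 «minimal counterexample / extremal reduction», gen 17; RESIDUAL MODE)

Child node — refines RegularAvatarReduction:RegularNonLiftableAutomorphy.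

TARGET. REG = `Summit.Langlands.Langlands.Theses.RegularAvatarReduction.RegularNonLiftableAutomorphy` (stmt-Langlands-28274; crux r2, OPEN, never split, the DECLARED RESIDUAL of
route-Langlands-RegularAvatarReduction rev 1 @4bfe91d1c6d4 — the lens-4 g16 child of NonLiftableResidueReduction at NLR 28006, itself the g15 child of InsolubleResidueReduction at INS 27765,
the g14 child of MinimalLevelDescent rev 3 at B₂ 27523; tree twin `LevelOneDyadic.Regular.RegularNonLiftableAutomorphy`, same text, `regularNonLiftableAutomorphy_route_iff_twin : _ ↔ _ := Iff.rfl`):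
every irreducible, pinned-geometric, HODGE–TATE-REGULAR 2-adic ρ : Γ_K → GL_n(ℚ̄₂) unramified away from 2 whose residual representations τ have INSOLUBLE image and which shares a residue with
NO finite-image irreducible σ is RESIDUALLY automorphic (a cuspidal L-algebraic π with Satake ≡ Frobenius(ρ) mod 𝔪(ℤ̄₂) a.e.).

CONSTRUCTION (one dial, one excluded middle, 0 sorry; the FIRST AUTOMORPHIC-SIDE dial of the residue lineage — g14 solubility, g15 Artin-liftability, g16 Hodge–Tate type of the best
avatar were Galois-side invariants of τ).  DIAL `HasTorsionAvatar ρ` := «some reduction ρ̄ of ρ (an honest `FramedGaloisRep K 𝔽̄₂ n` with `ρ.IsReductionOf id ↑ρ̄`, 𝔽̄₂ =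
`padicAlgClResidueField 2` with the DISCRETE topology) is associated with a continuous 𝔽̄₂-valued eigensystem of Scholze's completed-cohomology Hecke algebra 𝕋(K^{(2)}) of GL_n/K at FULL TAME
LEVEL» — `(BigHeckeGLn.TameLevel.full n K 2).IsPadicallyAutomorphic ρ̄`, the tree's own CONSTRUCTED object and predicate (CompletedCohomologyHeckeAlgebraGLn.lean: `TameLevel.full` :695,
`IsPadicallyAutomorphic` :520, `IsAssociated` :508 — charpoly(ρ̄(Frob_v)) = heckeFrobPoly(ψ(T_{v,·})) at v ∤ 2; continuity of ψ : 𝕋 → 𝔽̄₂^disc = open kernel = ψ factors through a finite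
torsion level: «ρ̄ OCCURS IN H^•(X_{U(2^r)}, ℤ/2^s)»).  `hasTorsionAvatar_iff` unfolds it to (τ, ψ, Continuous ψ ∧ IsAssociated ψ τ) by `Iff.rfl`; `HasTorsionAvatar.exists_eigensystem` extracts
ψ with OPEN PRIME kernel (no junk inhabitant); `exists_isReductionOf` (every ρ has a reduction, via the tree's `exists_integralModel_of_valuationSubring` — stable lattices over 𝒪_{ℚ̄₂}) shows
the dial is never vacuously false for want of a reduction; association reads only charpolys, so the dial does not depend on the chosen reduction.  Cells:
* TA `TorsionAvatarAutomorphy` (crux r3, NEW, ATTACKABLE NOW on the automorphic side) = REG ∧ dial — THE TORSION AVATAR LIFTS: Ash–Calegari–Venkatesh torsion lifting at ℓ = 2;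
* AL `AvatarlessResidueAutomorphy` (crux r2, the NEW DECLARED RESIDUAL) = REG ∧ ¬dial — the 2-ADICALLY DARK residues: pure automorphic existence mod 2;
* FRAME⁗ `RegularResidueFrame` (support r9) = `RegularAvatarReduction.RegularNonLiftableAutomorphy → Langlands` (the parent route below REG).
KERNEL I (EXACT) `regularNonLiftableAutomorphy_iff_cells : REG ↔ (TA ∧ AL)`: `regular_of_cells` by `dial_dichotomy` (the dial is a hypothesis on ρ itself, so NO transfer lemma is needed —
contrast g16, which moved automorphy along a shared residue by KERNEL III); conversely `torsionAvatar_of_regular`, `avatarless_of_regular` (forget the dial); twin form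
`regularNonLiftableAutomorphy_twin_iff_cells`.  KERNEL II necessity from the summit through the landed tower: `regular_of_langlands` (twin `Regular.regular_of_langlands`),
`torsionAvatar_of_langlands`, `avatarless_of_langlands`, `cells_of_nonLiftable` (⟸ NLR 28006 via `Regular.regular_of_nonLiftable`), `cells_of_insoluble` (⟸ INS 27765), `cells_of_dyadic`
(⟸ B₂ 27523), `frame_of_host` (FRAME⁗ from the parent's NRA 28275 and FRAME‴ 28276 binders through the gate-certified `RegularAvatarReduction.closes`), `frame_of_grandhost` (from
NonLiftableResidueReduction's LART / FRAME″ via the twin `Regular.closes`), `frame_of_langlands`.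
KERNEL III⁗ THE VACUITY ENGINE (node-only, NOT an item, NOT S-implied — kit probe 20): `TorsionSerreReciprocity` (TSR) := «every level-one irreducible pinned-geometric HT-regular ρ with
insoluble non-Artin residue HAS a torsion avatar» — MOD-2 TORSION SERRE RECIPROCITY on the box (Ash–Sinnott / Ash–Doud–Pollack / Herzig over ℚ; Figueiredo / Şengün / Torrey over imaginary
quadratic K; Buzzard–Diamond–Jarvis over totally real K; Calegari–Venkatesh «reciprocity over ℤ»; a THEOREM only over ℚ — Khare–Wintenberger, vacuous in the box at level one by Tate);
`avatarless_of_reciprocity : TSR → AL` (PROVED: under TSR the hypothesis ¬dial of AL is absurd), `regular_of_torsionAvatar_of_reciprocity : TA → TSR → REG`.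
LINES (stubs as hypotheses, all S-implied: `lineStubs_of_langlands`, `birthStubs_of_langlands`): TA by the CALEGARI–GERAGHTY DEFECT l₀ of Res_{K/ℚ}GL_n on the box —
`torsionAvatar_of_defects : TA₀ → TA₊ → TA` with TA₀ = (n = 2 ∧ K totally real: l₀ = 0; torsion-freeness at a generic non-Eisenstein 𝔪 — Caraiani–Tamiozzo 2023, ℓ > 2: THE DYADIC GAP —
then Deligne–Serre lifting, tree-PROVED `Literature.Algebra.Module.deligneSerre_lifting_of_free`, then cuspidality of characteristic-0 non-Eisenstein classes) and TA₊ = (l₀ > 0: Bianchi,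
GL_n≥3, other K; Calegari–Geraghty patching at ℓ = 2, dark); AL by RANK — `avatarless_of_ranks : AL≤2 → AL≥3 → AL`, `avatarless_of_serreRankTwo : TSR≤2 → AL≥3 → AL` (rank ≤ 2 emptied by the
reciprocity stub via `absurd`), `serreRankTwo_of_reciprocity`; the RUNG `rung_of_torsionAvatar : TA → RUNG` (TA for totally real K, n = 2 — the defect-zero sector, plan-only BC5).
KERNEL V `closes_framed (hT : TA) (hA : AL) (hF : FRAME⁗) : Langlands`, `closes (hT) (hA) (hN : NRA) (hF‴) : Langlands` (= the parent's `RegularAvatarReduction.closes` with REG assembled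
from the cells), `closes_host` (five binders through the twin `Regular.closes`), `closes_grandhost` (seven binders through `Regular.closes_host`), `rung_of_cells` (→
`MinimalLevelDescent.DyadicLevelOneRankTwoQ` at (ℚ, 2) through the twin tower's `Regular.rung_of_cells`).

WHY STRICTLY WEAKER. TA, AL ⟸ REG (`torsionAvatar_of_regular`, `avatarless_of_regular`); neither gives REG back (kit probes 3–6 fail on the route decl AND the twin: `exact h0`, `aesop`,
`exact?` — TA says nothing about avatarless ρ, AL nothing about ρ with an avatar), nor the summit (probes 1–2), nor NRA 28275 (12–13), NLR 28006 (14–15), INS 27765 (16–17), B₂ 27523 (18);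
each of the three binders of `closes_framed` is load-bearing (drop-one probes 9–11 fail); TA ↛ AL and AL ↛ TA (34–35).  FRAME⁗ is S-implied trivially and used toward S (probes 7–8: it gives
neither S nor REG).  TSR is NOT S-implied (probe 20) and gives neither the summit, REG nor TA (19, 21, 22) — an engine, not a piece; no line/birth/rung stub gives its crux or the summit
(23–33).  105 expected-fail examples = 105 errors, 0 elsewhere; bc7 `#h21_crux_probe` CLEAN ×3 (FRAME⁗ informational summit-implies).

WHY NOVEL (problem-relative).  After three Galois-side cuts, REG is a regular-weight residual statement whose only remaining freedom is AUTOMORPHIC: is ρ̄ seen by any automorphic structure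
at all?  The weakest automorphic structure that can see a mod-2 residue is TORSION cohomology (Ash 1992; Calegari–Venkatesh «reciprocity over ℤ» §1.4; Scholze 2015: torsion classes have
Galois representations — the tree's `BigHeckeGLn`).  Cutting by it converts «find a cusp form congruent to ρ» into (TA) a torsion LIFTING statement with named engines and a NAMED GAP (every
torsion-vanishing theorem in print — Caraiani–Scholze, Caraiani–Tamiozzo Thm 7.1.1, Koshikawa, Hamann–Lee; Mokrane–Tilouine's p − 1 > w — excludes ℓ = 2, and «generic from insoluble image»
needs ℓ > 2: Caraiani–Shin Rem 4.8) and (AL) a torsion EXISTENCE statement with a PROVED vacuity kernel — the Calegari–Venkatesh two-step made into an exact decomposition at (ℓ, level) =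
(2, 1) for all K, n, mirror-symmetric to g16's Khare–Wintenberger two-step on the Galois side (NLR ⟺ REG ∧ NRA ⟸ DMRL).  No cell of the decomp-langlands tree uses the completed-cohomology
Hecke algebra at ℓ = 2 or a torsion-occurrence hypothesis (`rg IsPadicallyAutomorphic|TameLevel.full Summits/Langlands`: none in Theses); lens-3 g11 VisibilitySplit dials CHARACTERISTIC-0
𝕋-points of ρ itself in IRREGULAR weight over totally real K, and its residual-visibility annex (`ResiduallyVisibleAt`, UNCHECKED, never filed) is the nearest predicate — credited: the g17
dial is that predicate at full tame level and ℓ = 2 applied to a RESIDUAL statement in REGULAR weight, where it is an exact cut with a LIFTING cell; lens-4 g0 Classicality / FernSpread and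
lens-5 g0 ResidualLink use characteristic-0 avatars («τ has a classical avatar» would be REG restated — rejected as costume in the kit's repair census).  Searches (corpus fts+vec, galaxy,
tree) and nearest prior art (Calegari–Venkatesh 2019, Caraiani–Tamiozzo 2023, Calegari–Geraghty 2018, Khare–Wintenberger 2009, the torsion Serre conjectures) in the kit card.

ORBIT CLOSURE.  The dial depends on ρ only through the prime-to-2 characteristic polynomials of ρ̄ (hence only on τ = ρ̄^ss) and is invariant under twists by level-one finite-order
characters (twist the eigensystem: 𝕋 carries the diamond operators), duals (transpose level structure; `TameLevel.full` is self-dual) and Frobenius of the coefficients (σ ∘ ψ); REG is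
orbit-closed (g16).  TYPING: `letI := ⊥` fixes the residue field's topology inside the Prop (the tree's own idiom in `PadicallyAutomorphicResidualEigensystem`), so the item elaborates
under the gate's bare `import Mathlib`-style render (native check OK, 148-line render, bc7 CLEAN); TA ∪ AL = REG by one excluded middle.  INHERITANCE «2-adically automorphic of full tame
level ⟹ torsion avatar» (tree `IsPadicallyAutomorphic.exists_isResidualRepAt`) is in the kit annex, UNCHECKED only because the farm snapshot has not built that Literature module.

AXIOMS.  Every kernel theorem depends on exactly [propext, Classical.choice, Quot.sound] (kit `.probesB.lean` `#guard_msgs` ×29).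
-/

set_option linter.dupNamespace false

namespace Summit.Langlands.Langlands.Theorems.LevelOneDyadic.Torsion

open scoped NumberField
open Filter IsDedekindDomain Polynomial
open Literature.NumberTheory.GaloisRepresentations Literature.NumberTheory.Automorphic
open Literature.NumberTheory.Automorphic.BigHeckeGLn
open Summit.Langlands.Langlands.Theses
open Summit.Langlands.Langlands.Theorems.LevelOneDyadic
open Summit.Langlands.Langlands.Theorems.LevelOneDyadic.Residue
open Summit.Langlands.Langlands.Theorems.LevelOneDyadic.Liftable

variable {K : Type} [Field K] [NumberField K] {n : ℕ}

/-! ## Vocabulary — the dial: does ρ have a TORSION AVATAR (is ρ̄ seen by the completed cohomology of GL_n/K at full tame level, mod 2)? -/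

/-- THE DIAL (the first AUTOMORPHIC-SIDE dial of the residue lineage).  ρ : Γ_K → GL_n(ℚ̄₂) has a TORSION AVATAR: some reduction
τ̄ : Γ_K → GL_n(𝔽̄₂) of ρ (tree `FramedGaloisRep.IsReductionOf`, framed over the residue field 𝔽̄₂ = ℤ̄₂/𝔪 with the DISCRETE topology) is
ASSOCIATED — unramified at every v ∤ 2 with det(X − τ̄(Frob_v)) = the Hecke–Frobenius polynomial of ψ(T_{v,1}), …, ψ(T_{v,n}) (tree
`TameLevel.IsAssociated`) — with a CONTINUOUS mod-2 eigensystem ψ : 𝕋(K^{(2)}) → 𝔽̄₂ of Scholze's completed-cohomology Hecke algebra of GL_n/K at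
FULL TAME LEVEL U = GL_n(𝒪̂_K), S = {v ∣ 2} (tree `CompletedCohomologyHeckeAlgebraGLn (TameLevel.full n K 2)`, `TameLevel.IsPadicallyAutomorphic` read over
𝔽̄₂); continuity for the discrete topology = OPEN KERNEL, i.e. ψ factors through a finite-level torsion Hecke algebra 𝕋(U(2^r), ℤ/2^s): «ρ̄ OCCURS IN
H^•(X_{U(2^r)}, ℤ/2^s) for some r, s».  Depends on ρ only through the characteristic polynomials of ρ̄ (association reads charpolys and unramifiedness, so
every reduction, semisimple or not, gives the same answer); stable under twists by level-2^∞ characters mod 2 (none but 1 at level one: ω₂ is trivial),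
duals, Frobenius of the coefficients, and — conjecturally, by mod-2 functoriality (Treumann–Venkatesh) — upward under quadratic base change.  Every
2-ADICALLY AUTOMORPHIC ρ of full tame level has a torsion avatar (tree `IsPadicallyAutomorphic.exists_isResidualRepAt`, Literature
`PadicallyAutomorphicResidualEigensystem` — landed, farm snapshot unbuilt this session: the 6-line corollary is the kit's UNCHECKED annex); the converse
fails exactly at torsion classes that do not lift.  Every ρ HAS a reduction (`exists_isReductionOf`): the dial never fails for want of one. [dial, ℓ = 2] -/
def HasTorsionAvatar (ρ : FramedGaloisRep K (PadicAlgCl 2) n) : Prop := (letI : TopologicalSpace (Literature.NumberTheory.GaloisRepresentations.padicAlgClResidueField 2) := ⊥; ∃ τ : Literature.NumberTheory.GaloisRepresentations.FramedGaloisRep K (Literature.NumberTheory.GaloisRepresentations.padicAlgClResidueField 2) n, ρ.IsReductionOf (RingHom.id (Literature.NumberTheory.GaloisRepresentations.padicAlgClResidueField 2)) (τ : Field.absoluteGaloisGroup K →* GL (Fin n) (Literature.NumberTheory.GaloisRepresentations.padicAlgClResidueField 2)) ∧ (Literature.NumberTheory.Automorphic.BigHeckeGLn.TameLevel.full n K 2).IsPadicallyAutomorphic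 τ)

/-! ## The pieces (filed texts, verbatim = the child route's items; REG = the born route decl, imported BY NAME) -/

/-- [crux TA · NEW · WEAKER(`torsionAvatar_of_regular`, `torsionAvatar_of_langlands`; no `TA → REG`: the avatarless instances are outside it) · OPEN ·
ATTACKABLE NOW on the AUTOMORPHIC side: TA is the Ash–Calegari–Venkatesh TORSION LIFTING problem at an insoluble (non-Eisenstein) non-Artin HT-regular mod-2
residue — defect l₀ = 0 (n = 2, K totally real): torsion-freeness/vanishing of the cohomology of the Hilbert modular variety at a non-Eisenstein generic 𝔪
(Caraiani–Tamiozzo 2023, ℓ > 2: the named DYADIC GAP) + the tree-PROVED Deligne–Serre lifting lemma + «characteristic-0 non-Eisenstein classes are cuspidal»;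
defect l₀ > 0: the Calegari–Geraghty programme at ℓ = 2 · line TA₀ ∧ TA₊ (defect cut)]
REG restricted to ρ WITH a torsion avatar. -/
def TorsionAvatarAutomorphy : Prop := ∀ (K : Type) [Field K] [NumberField K] (n : ℕ) (hcpt : Literature.NumberTheory.Automorphic.isCompact_glFiniteIntegralLevel n K), 0 < n → ∀ (ι : PadicAlgCl 2 ≃+* ℂ) (ρ : Literature.NumberTheory.GaloisRepresentations.FramedGaloisRep K (PadicAlgCl 2) n), ρ.toGaloisRep.IsIrreducible → (∀ τ : Field.absoluteGaloisGroup K →* GL (Fin n) (Literature.NumberTheory.GaloisRepresentations.padicAlgClResidueField 2), ρ.IsResidualRepOf (RingHom.id (Literature.NumberTheory.GaloisRepresentations.padicAlgClResidueField 2)) τ → ¬ IsSolvable τ.range) → ¬ (∃ (σ : Literature.NumberTheory.GaloisRepresentations.FramedGaloisRep K (PadicAlgCl 2) n) (τ : Field.absoluteGaloisGroup K →* GL (Fin n) (Literature.NumberTheory.GaloisRepresentations.padicAlgClResidueField 2)), (Set.range (fun g : Field.absoluteGaloisGroup K => σ g)).Finite ∧ σ.toGaloisRep.IsIrreducible ∧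 ρ.IsResidualRepOf (RingHom.id (Literature.NumberTheory.GaloisRepresentations.padicAlgClResidueField 2)) τ ∧ σ.IsResidualRepOf (RingHom.id (Literature.NumberTheory.GaloisRepresentations.padicAlgClResidueField 2)) τ) → ((∀ᶠ v : IsDedekindDomain.HeightOneSpectrum (NumberField.RingOfIntegers K) in cofinite, ρ.IsUnramifiedAt v) ∧ ∀ (v : IsDedekindDomain.HeightOneSpectrum (NumberField.RingOfIntegers K)) (hv : ((2 : ℕ) : NumberField.RingOfIntegers K) ∈ v.asIdeal), (Literature.NumberTheory.PAdicHodge.fontainePstAdicCompletion v 2 hv).IsDeRhamFramed (ρ.toLocal v)) → (∀ (v : IsDedekindDomain.HeightOneSpectrum (NumberField.RingOfIntegers K)) (hv : ((2 : ℕ) : NumberField.RingOfIntegers K) ∈ v.asIdeal), ∀ e : v.adicCompletion K →+* PadicAlgCl 2, Continuous e → (ρ.labelledHodgeTateWeightsAt v (Literature.NumberTheory.PAdicHodge.fontainePstAdicCompletion v 2 hv).algebra (Literature.NumberTheory.PAdicHodge.fontainePstAdicCompletion v 2 hv).𝔅 e).Nodup) → (∀ v : IsDedekindDomain.HeightOneSpectrum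 (NumberField.RingOfIntegers K), ((2 : ℕ) : NumberField.RingOfIntegers K) ∉ v.asIdeal → ρ.IsUnramifiedAt v) → (letI : TopologicalSpace (Literature.NumberTheory.GaloisRepresentations.padicAlgClResidueField 2) := ⊥; ∃ τ : Literature.NumberTheory.GaloisRepresentations.FramedGaloisRep K (Literature.NumberTheory.GaloisRepresentations.padicAlgClResidueField 2) n, ρ.IsReductionOf (RingHom.id (Literature.NumberTheory.GaloisRepresentations.padicAlgClResidueField 2)) (τ : Field.absoluteGaloisGroup K →* GL (Fin n) (Literature.NumberTheory.GaloisRepresentations.padicAlgClResidueField 2)) ∧ (Literature.NumberTheory.Automorphic.BigHeckeGLn.TameLevel.full n K 2).IsPadicallyAutomorphic τ) → ∃ π : Literature.NumberTheory.Automorphic.CuspidalAutomorphicRepData n K hcpt, π.1.IsLAlgebraic ∧ ∀ᶠ v : IsDedekindDomain.HeightOneSpectrum (NumberField.RingOfIntegers K) in cofinite, ρ.IsUnramifiedAt v ∧ (∃ α : Multiset ℂ, π.1.HasSatakeParamAt v α) ∧ ∀ α : Multiset ℂ, π.1.HasSatakeParamAt v α → ∃ P Q : Polynomial (Valued.v :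 Valuation (PadicAlgCl 2) NNReal).valuationSubring, ρ.HasFrobCharpolyAt v (P.map (Valued.v : Valuation (PadicAlgCl 2) NNReal).valuationSubring.subtype) ∧ Literature.NumberTheory.Automorphic.arithFrobPolyOfSatake ι v.residueCard 1 α = Q.map (Valued.v : Valuation (PadicAlgCl 2) NNReal).valuationSubring.subtype ∧ P.map (IsLocalRing.residue (Valued.v : Valuation (PadicAlgCl 2) NNReal).valuationSubring) = Q.map (IsLocalRing.residue (Valued.v : Valuation (PadicAlgCl 2) NNReal).valuationSubring)

/-- [crux AL · THE NEW DECLARED RESIDUAL · WEAKER(`avatarless_of_regular`, `avatarless_of_langlands`; no `AL → REG`) · OPEN · the «2-ADICALLY DARK» normal form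
of the minimal counterexample: an HT-regular level-one ρ with insoluble non-Artin residue that NO torsion eigensystem of GL_n/K at tame level one sees —
VACUOUS under MOD-2 TORSION SERRE RECIPROCITY (`avatarless_of_reciprocity : TorsionSerreReciprocity → AL`, proved; Ash–Sinnott / Ash–Doud–Pollack /
Figueiredo / Şengün–Torrey / Calegari–Venkatesh «reciprocity over ℤ») and disjoint from the whole 2-adically automorphic locus of full tame
level (tree `IsPadicallyAutomorphic.exists_isResidualRepAt`; annex) · IDEA-NEEDED / BARRIER: constructing a torsion class from Galois data has no engine beyond K = ℚ
(Khare–Wintenberger, through characteristic 0) · birth AL≤2 ∧ AL≥3 (rank cut)]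
REG restricted to ρ WITHOUT a torsion avatar. -/
def AvatarlessResidueAutomorphy : Prop := ∀ (K : Type) [Field K] [NumberField K] (n : ℕ) (hcpt : Literature.NumberTheory.Automorphic.isCompact_glFiniteIntegralLevel n K), 0 < n → ∀ (ι : PadicAlgCl 2 ≃+* ℂ) (ρ : Literature.NumberTheory.GaloisRepresentations.FramedGaloisRep K (PadicAlgCl 2) n), ρ.toGaloisRep.IsIrreducible → (∀ τ : Field.absoluteGaloisGroup K →* GL (Fin n) (Literature.NumberTheory.GaloisRepresentations.padicAlgClResidueField 2), ρ.IsResidualRepOf (RingHom.id (Literature.NumberTheory.GaloisRepresentations.padicAlgClResidueField 2)) τ → ¬ IsSolvable τ.range) → ¬ (∃ (σ : Literature.NumberTheory.GaloisRepresentations.FramedGaloisRep K (PadicAlgCl 2) n) (τ : Field.absoluteGaloisGroup K →* GL (Fin n) (Literature.NumberTheory.GaloisRepresentations.padicAlgClResidueField 2)), (Set.range (fun g : Field.absoluteGaloisGroup K => σ g)).Finite ∧ σ.toGaloisRep.IsIrreducible ∧ ρ.IsResidualRepOf (RingHom.id (Literature.NumberTheory.GaloisRepresentations.padicAlgClResidueField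 2)) τ ∧ σ.IsResidualRepOf (RingHom.id (Literature.NumberTheory.GaloisRepresentations.padicAlgClResidueField 2)) τ) → ((∀ᶠ v : IsDedekindDomain.HeightOneSpectrum (NumberField.RingOfIntegers K) in cofinite, ρ.IsUnramifiedAt v) ∧ ∀ (v : IsDedekindDomain.HeightOneSpectrum (NumberField.RingOfIntegers K)) (hv : ((2 : ℕ) : NumberField.RingOfIntegers K) ∈ v.asIdeal), (Literature.NumberTheory.PAdicHodge.fontainePstAdicCompletion v 2 hv).IsDeRhamFramed (ρ.toLocal v)) → (∀ (v : IsDedekindDomain.HeightOneSpectrum (NumberField.RingOfIntegers K)) (hv : ((2 : ℕ) : NumberField.RingOfIntegers K) ∈ v.asIdeal), ∀ e : v.adicCompletion K →+* PadicAlgCl 2, Continuous e → (ρ.labelledHodgeTateWeightsAt v (Literature.NumberTheory.PAdicHodge.fontainePstAdicCompletion v 2 hv).algebra (Literature.NumberTheory.PAdicHodge.fontainePstAdicCompletion v 2 hv).𝔅 e).Nodup) → (∀ v : IsDedekindDomain.HeightOneSpectrum (NumberField.RingOfIntegers K), ((2 : ℕ) : NumberField.RingOfIntegers K) ∉ v.asIdeal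 → ρ.IsUnramifiedAt v) → ¬ (letI : TopologicalSpace (Literature.NumberTheory.GaloisRepresentations.padicAlgClResidueField 2) := ⊥; ∃ τ : Literature.NumberTheory.GaloisRepresentations.FramedGaloisRep K (Literature.NumberTheory.GaloisRepresentations.padicAlgClResidueField 2) n, ρ.IsReductionOf (RingHom.id (Literature.NumberTheory.GaloisRepresentations.padicAlgClResidueField 2)) (τ : Field.absoluteGaloisGroup K →* GL (Fin n) (Literature.NumberTheory.GaloisRepresentations.padicAlgClResidueField 2)) ∧ (Literature.NumberTheory.Automorphic.BigHeckeGLn.TameLevel.full n K 2).IsPadicallyAutomorphic τ) → ∃ π : Literature.NumberTheory.Automorphic.CuspidalAutomorphicRepData n K hcpt, π.1.IsLAlgebraic ∧ ∀ᶠ v : IsDedekindDomain.HeightOneSpectrum (NumberField.RingOfIntegers K) in cofinite, ρ.IsUnramifiedAt v ∧ (∃ α : Multiset ℂ, π.1.HasSatakeParamAt v α) ∧ ∀ α : Multiset ℂ, π.1.HasSatakeParamAt v α → ∃ P Q : Polynomial (Valued.v : Valuation (PadicAlgCl 2) NNReal).valuationSubring, ρ.HasFrobCharpolyAt v (P.map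 (Valued.v : Valuation (PadicAlgCl 2) NNReal).valuationSubring.subtype) ∧ Literature.NumberTheory.Automorphic.arithFrobPolyOfSatake ι v.residueCard 1 α = Q.map (Valued.v : Valuation (PadicAlgCl 2) NNReal).valuationSubring.subtype ∧ P.map (IsLocalRing.residue (Valued.v : Valuation (PadicAlgCl 2) NNReal).valuationSubring) = Q.map (IsLocalRing.residue (Valued.v : Valuation (PadicAlgCl 2) NNReal).valuationSubring)

/-- [support FRAME⁗ · content = the born route-Langlands-RegularAvatarReduction rev 0 VERBATIM below REG: `REG → Langlands`, i.e. its two other deciding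
binders NRA `NoRegularAvatarAutomorphy` 28275 and FRAME‴ `NonLiftableResidueFrame` 28276 through `RegularAvatarReduction.closes` (certified `frame_of_host`);
Langlands ⟹ FRAME⁗ trivially (`frame_of_langlands`).  Same device as FRAME‴ one level up.] -/
def RegularResidueFrame : Prop := Summit.Langlands.Langlands.Theses.RegularAvatarReduction.RegularNonLiftableAutomorphy → _root_.Langlands

/-- [engine TSR, node-only · NOT an item (not S-implied in-tree: an automorphic EXISTENCE statement mod 2) · the ATTACK on AL (`avatarless_of_reciprocity`)]
MOD-2 TORSION SERRE RECIPROCITY on the REG box: every level-one, irreducible, pinned-geometric, HT-regular ρ : Γ_K → GL_n(ℚ̄₂) with insoluble non-Artin residue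
HAS A TORSION AVATAR — its residue occurs in the mod-2 (torsion) cohomology of GL_n/K at full tame level. -/
def TorsionSerreReciprocity : Prop := ∀ (K : Type) [Field K] [NumberField K] (n : ℕ) (hcpt : Literature.NumberTheory.Automorphic.isCompact_glFiniteIntegralLevel n K), 0 < n → ∀ (ι : PadicAlgCl 2 ≃+* ℂ) (ρ : Literature.NumberTheory.GaloisRepresentations.FramedGaloisRep K (PadicAlgCl 2) n), ρ.toGaloisRep.IsIrreducible → (∀ τ : Field.absoluteGaloisGroup K →* GL (Fin n) (Literature.NumberTheory.GaloisRepresentations.padicAlgClResidueField 2), ρ.IsResidualRepOf (RingHom.id (Literature.NumberTheory.GaloisRepresentations.padicAlgClResidueField 2)) τ → ¬ IsSolvable τ.range) → ¬ (∃ (σ : Literature.NumberTheory.GaloisRepresentations.FramedGaloisRep K (PadicAlgCl 2) n) (τ : Field.absoluteGaloisGroup K →* GL (Fin n) (Literature.NumberTheory.GaloisRepresentations.padicAlgClResidueField 2)), (Set.range (fun g : Field.absoluteGaloisGroup K => σ g)).Finite ∧ σ.toGaloisRep.IsIrreducible ∧ ρ.IsResidualRepOf (RingHom.id (Literature.NumberTheory.GaloisRepresentations.padicAlgClResidueField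 2)) τ ∧ σ.IsResidualRepOf (RingHom.id (Literature.NumberTheory.GaloisRepresentations.padicAlgClResidueField 2)) τ) → ((∀ᶠ v : IsDedekindDomain.HeightOneSpectrum (NumberField.RingOfIntegers K) in cofinite, ρ.IsUnramifiedAt v) ∧ ∀ (v : IsDedekindDomain.HeightOneSpectrum (NumberField.RingOfIntegers K)) (hv : ((2 : ℕ) : NumberField.RingOfIntegers K) ∈ v.asIdeal), (Literature.NumberTheory.PAdicHodge.fontainePstAdicCompletion v 2 hv).IsDeRhamFramed (ρ.toLocal v)) → (∀ (v : IsDedekindDomain.HeightOneSpectrum (NumberField.RingOfIntegers K)) (hv : ((2 : ℕ) : NumberField.RingOfIntegers K) ∈ v.asIdeal), ∀ e : v.adicCompletion K →+* PadicAlgCl 2, Continuous e → (ρ.labelledHodgeTateWeightsAt v (Literature.NumberTheory.PAdicHodge.fontainePstAdicCompletion v 2 hv).algebra (Literature.NumberTheory.PAdicHodge.fontainePstAdicCompletion v 2 hv).𝔅 e).Nodup) → (∀ v : IsDedekindDomain.HeightOneSpectrum (NumberField.RingOfIntegers K), ((2 : ℕ) : NumberField.RingOfIntegers K) ∉ v.asIdeal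 → ρ.IsUnramifiedAt v) → (letI : TopologicalSpace (Literature.NumberTheory.GaloisRepresentations.padicAlgClResidueField 2) := ⊥; ∃ τ : Literature.NumberTheory.GaloisRepresentations.FramedGaloisRep K (Literature.NumberTheory.GaloisRepresentations.padicAlgClResidueField 2) n, ρ.IsReductionOf (RingHom.id (Literature.NumberTheory.GaloisRepresentations.padicAlgClResidueField 2)) (τ : Field.absoluteGaloisGroup K →* GL (Fin n) (Literature.NumberTheory.GaloisRepresentations.padicAlgClResidueField 2)) ∧ (Literature.NumberTheory.Automorphic.BigHeckeGLn.TameLevel.full n K 2).IsPadicallyAutomorphic τ)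

/-! ## Bridges — every filed text is the vocabulary form, definitionally (`Iff.rfl`) -/

/-- The born route decl REG (stmt-Langlands-28274) IS the tree twin's `Regular.RegularNonLiftableAutomorphy` (same text). -/
theorem regularNonLiftableAutomorphy_route_iff_twin :
    RegularAvatarReduction.RegularNonLiftableAutomorphy ↔ Regular.RegularNonLiftableAutomorphy :=
  Iff.rfl

/-- The born route decl NRA (stmt-Langlands-28275) IS the twin's `Regular.NoRegularAvatarAutomorphy`. -/
theorem noRegularAvatarAutomorphy_route_iff_twin :
    RegularAvatarReduction.NoRegularAvatarAutomorphy ↔ Regular.NoRegularAvatarAutomorphy :=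
  Iff.rfl

/-- REG (the born route decl) in vocabulary form. -/
theorem regularNonLiftableAutomorphy_iff : RegularAvatarReduction.RegularNonLiftableAutomorphy ↔
    ∀ (K : Type) [Field K] [NumberField K] (n : ℕ) (hcpt : isCompact_glFiniteIntegralLevel n K), 0 < n →
      ∀ (ι : PadicAlgCl 2 ≃+* ℂ) (ρ : FramedGaloisRep K (PadicAlgCl 2) n), ρ.toGaloisRep.IsIrreducible →
        IsResiduallyInsoluble ρ → ¬ IsArtinLiftableResidue ρ → IsPinnedGeometric ρ → Regular.IsHodgeTateRegularAboveTwo ρ →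
          IsUnramifiedAwayFromTwo ρ → IsResiduallyAutomorphic hcpt ι ρ :=
  Iff.rfl

/-- The dial in vocabulary form: a framed mod-2 reduction of ρ associated with a continuous (= open-kernel) mod-2 eigensystem of 𝕋(K^{(2)}) at full tame level. -/
theorem hasTorsionAvatar_iff (ρ : FramedGaloisRep K (PadicAlgCl 2) n) : HasTorsionAvatar ρ ↔
    letI : TopologicalSpace (padicAlgClResidueField 2) := ⊥
    ∃ τ : FramedGaloisRep K (padicAlgClResidueField 2) n,
      ρ.IsReductionOf (RingHom.id _) (τ : Field.absoluteGaloisGroup K →* GL (Fin n) (padicAlgClResidueField 2)) ∧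
        ∃ ψ : CompletedCohomologyHeckeAlgebraGLn (TameLevel.full n K 2) →+* padicAlgClResidueField 2,
          Continuous ψ ∧ (TameLevel.full n K 2).IsAssociated ψ τ :=
  Iff.rfl

/-- TA in vocabulary form. -/
theorem torsionAvatarAutomorphy_iff : TorsionAvatarAutomorphy ↔
    ∀ (K : Type) [Field K] [NumberField K] (n : ℕ) (hcpt : isCompact_glFiniteIntegralLevel n K), 0 < n →
      ∀ (ι : PadicAlgCl 2 ≃+* ℂ) (ρ : FramedGaloisRep K (PadicAlgCl 2) n), ρ.toGaloisRep.IsIrreducible →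
        IsResiduallyInsoluble ρ → ¬ IsArtinLiftableResidue ρ → IsPinnedGeometric ρ → Regular.IsHodgeTateRegularAboveTwo ρ →
          IsUnramifiedAwayFromTwo ρ → HasTorsionAvatar ρ → IsResiduallyAutomorphic hcpt ι ρ :=
  Iff.rfl

/-- AL in vocabulary form. -/
theorem avatarlessResidueAutomorphy_iff : AvatarlessResidueAutomorphy ↔
    ∀ (K : Type) [Field K] [NumberField K] (n : ℕ) (hcpt : isCompact_glFiniteIntegralLevel n K), 0 < n →
      ∀ (ι : PadicAlgCl 2 ≃+* ℂ) (ρ : FramedGaloisRep K (PadicAlgCl 2) n), ρ.toGaloisRep.IsIrreducible →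
        IsResiduallyInsoluble ρ → ¬ IsArtinLiftableResidue ρ → IsPinnedGeometric ρ → Regular.IsHodgeTateRegularAboveTwo ρ →
          IsUnramifiedAwayFromTwo ρ → ¬ HasTorsionAvatar ρ → IsResiduallyAutomorphic hcpt ι ρ :=
  Iff.rfl

/-- FRAME⁗ is literally `REG → Langlands`. -/
theorem regularResidueFrame_iff :
    RegularResidueFrame ↔ (RegularAvatarReduction.RegularNonLiftableAutomorphy → _root_.Langlands) :=
  Iff.rfl

/-- TSR in vocabulary form. -/
theorem torsionSerreReciprocity_iff : TorsionSerreReciprocity ↔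
    ∀ (K : Type) [Field K] [NumberField K] (n : ℕ) (hcpt : isCompact_glFiniteIntegralLevel n K), 0 < n →
      ∀ (ι : PadicAlgCl 2 ≃+* ℂ) (ρ : FramedGaloisRep K (PadicAlgCl 2) n), ρ.toGaloisRep.IsIrreducible →
        IsResiduallyInsoluble ρ → ¬ IsArtinLiftableResidue ρ → IsPinnedGeometric ρ → Regular.IsHodgeTateRegularAboveTwo ρ →
          IsUnramifiedAwayFromTwo ρ → HasTorsionAvatar ρ :=
  Iff.rfl

/-! ## Dial logic — no junk: the avatar is an honest eigensystem with open kernel; every ρ has a reduction -/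

/-- One excluded middle: TA ∪ AL covers REG through `HasTorsionAvatar ρ ∨ ¬ HasTorsionAvatar ρ`. -/
theorem dial_dichotomy (ρ : FramedGaloisRep K (PadicAlgCl 2) n) : HasTorsionAvatar ρ ∨ ¬ HasTorsionAvatar ρ :=
  em _

/-- NO JUNK INHABITANT: a torsion avatar is an honest reduction τ̄ of ρ together with a mod-2 eigensystem ψ of 𝕋(K^{(2)}) whose kernel is an OPEN (prime)
ideal — so ψ factors through a finite-level torsion Hecke algebra — with τ̄ associated with ψ. -/
theorem HasTorsionAvatar.exists_eigensystem {ρ : FramedGaloisRep K (PadicAlgCl 2) n} (h : HasTorsionAvatar ρ) :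
    letI : TopologicalSpace (padicAlgClResidueField 2) := ⊥
    ∃ (τ : FramedGaloisRep K (padicAlgClResidueField 2) n)
      (ψ : CompletedCohomologyHeckeAlgebraGLn (TameLevel.full n K 2) →+* padicAlgClResidueField 2),
      ρ.IsReductionOf (RingHom.id _) (τ : Field.absoluteGaloisGroup K →* GL (Fin n) (padicAlgClResidueField 2)) ∧
        IsOpen ((RingHom.ker ψ : Ideal (CompletedCohomologyHeckeAlgebraGLn (TameLevel.full n K 2))) :
          Set (CompletedCohomologyHeckeAlgebraGLn (TameLevel.full n K 2))) ∧
        (RingHom.ker ψ).IsPrime ∧ (TameLevel.full n K 2).IsAssociated ψ τ := by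
  letI : TopologicalSpace (padicAlgClResidueField 2) := ⊥
  haveI : DiscreteTopology (padicAlgClResidueField 2) := ⟨rfl⟩
  obtain ⟨τ, hτ, ψ, hψc, hassoc⟩ := h
  refine ⟨τ, ψ, hτ, ?_, RingHom.ker_isPrime _, hassoc⟩
  have e : ((RingHom.ker ψ : Ideal (CompletedCohomologyHeckeAlgebraGLn (TameLevel.full n K 2))) :
      Set (CompletedCohomologyHeckeAlgebraGLn (TameLevel.full n K 2))) = ψ ⁻¹' {0} := by
    ext t
    rw [SetLike.mem_coe, RingHom.mem_ker, Set.mem_preimage, Set.mem_singleton_iff]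
  rw [e]
  exact (isOpen_discrete _).preimage hψc

/-- Every ρ : Γ_K → GL_n(ℚ̄₂) HAS a reduction mod 𝔪(ℤ̄₂) (integral model over the open valuation ring ℤ̄₂, tree `exists_integralModel_of_valuationSubring`,
then `integralReduction`) — so the dial never fails for want of a reduction. -/
theorem exists_isReductionOf (ρ : FramedGaloisRep K (PadicAlgCl 2) n) :
    ∃ τ : Field.absoluteGaloisGroup K →* GL (Fin n) (padicAlgClResidueField 2), ρ.IsReductionOf (RingHom.id _) τ := by
  obtain ⟨P, ρ₀, hP⟩ := exists_integralModel_of_valuationSubring (O := padicAlgClIntegers 2)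
    (Valued.isOpen_valuationSubring _) ρ
  exact ⟨integralReduction (RingHom.id _) ρ₀, ρ₀, 1, ⟨P, hP⟩, fun g => by rw [one_mul, inv_one, mul_one]⟩

/-! ## KERNEL I — exactness: REG ⟺ TA ∧ AL (one excluded middle on the dial; no transfer lemma needed: the dial is a hypothesis on ρ itself) -/

/-- REG ⟹ TA (drop the dial hypothesis). -/
theorem torsionAvatar_of_regular (hR : RegularAvatarReduction.RegularNonLiftableAutomorphy) : TorsionAvatarAutomorphy :=
  fun K _ _ n hcpt hn ι ρ hirr hins hnl hgeo hreg hlvl _ => hR K n hcpt hn ι ρ hirr hins hnl hgeo hreg hlvl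

/-- REG ⟹ AL (drop the negated dial hypothesis). -/
theorem avatarless_of_regular (hR : RegularAvatarReduction.RegularNonLiftableAutomorphy) : AvatarlessResidueAutomorphy :=
  fun K _ _ n hcpt hn ι ρ hirr hins hnl hgeo hreg hlvl _ => hR K n hcpt hn ι ρ hirr hins hnl hgeo hreg hlvl

/-- TA ∧ AL ⟹ REG — THE REDUCTION: given ρ, decide whether it has a torsion avatar; if so TA, if not AL. -/
theorem regular_of_cells (hT : TorsionAvatarAutomorphy) (hA : AvatarlessResidueAutomorphy) :
    RegularAvatarReduction.RegularNonLiftableAutomorphy := by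
  intro K _ _ n hcpt hn ι ρ hirr hins hnl hgeo hreg hlvl
  by_cases hav : HasTorsionAvatar ρ
  · exact (torsionAvatarAutomorphy_iff.mp hT) K n hcpt hn ι ρ hirr hins hnl hgeo hreg hlvl hav
  · exact (avatarlessResidueAutomorphy_iff.mp hA) K n hcpt hn ι ρ hirr hins hnl hgeo hreg hlvl hav

/-- THE EXACT DECOMPOSITION of the node: REG ⟺ TA ∧ AL. -/
theorem regularNonLiftableAutomorphy_iff_cells :
    RegularAvatarReduction.RegularNonLiftableAutomorphy ↔ (TorsionAvatarAutomorphy ∧ AvatarlessResidueAutomorphy) :=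
  ⟨fun hR => ⟨torsionAvatar_of_regular hR, avatarless_of_regular hR⟩, fun h => regular_of_cells h.1 h.2⟩

/-- The same decomposition read on the tree twin `Regular.RegularNonLiftableAutomorphy` (LevelOneDyadicRegular). -/
theorem regularNonLiftableAutomorphy_twin_iff_cells :
    Regular.RegularNonLiftableAutomorphy ↔ (TorsionAvatarAutomorphy ∧ AvatarlessResidueAutomorphy) :=
  regularNonLiftableAutomorphy_iff_cells

/-! ## KERNEL II — necessity from the summit: Langlands ⟹ REG ⟹ each cell; NLR / INS / B₂ ⟹ cells; the frame; the hosts -/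

/-- NECESSITY: Langlands ⟹ REG (the born decl; through the landed twin `Regular.regular_of_langlands`). [kernel certificate] -/
theorem regular_of_langlands (hLg : _root_.Langlands) : RegularAvatarReduction.RegularNonLiftableAutomorphy :=
  regularNonLiftableAutomorphy_route_iff_twin.mpr (Regular.regular_of_langlands hLg)

/-- NECESSITY: Langlands ⟹ TA. [kernel certificate] -/
theorem torsionAvatar_of_langlands (hLg : _root_.Langlands) : TorsionAvatarAutomorphy :=
  torsionAvatar_of_regular (regular_of_langlands hLg)

/-- NECESSITY: Langlands ⟹ AL. [kernel certificate] -/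
theorem avatarless_of_langlands (hLg : _root_.Langlands) : AvatarlessResidueAutomorphy :=
  avatarless_of_regular (regular_of_langlands hLg)

/-- NLR 28006 ⟹ TA ∧ AL (the cells sit below the grand-host crux NLR). -/
theorem cells_of_nonLiftable (hN : NonLiftableResidueReduction.NonLiftableResidueAutomorphy) :
    TorsionAvatarAutomorphy ∧ AvatarlessResidueAutomorphy :=
  regularNonLiftableAutomorphy_iff_cells.mp (regularNonLiftableAutomorphy_route_iff_twin.mpr (Regular.regular_of_nonLiftable hN))

/-- INS 27765 ⟹ TA ∧ AL. -/
theorem cells_of_insoluble (hI : InsolubleResidueReduction.InsolubleResidueAutomorphy) :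
    TorsionAvatarAutomorphy ∧ AvatarlessResidueAutomorphy :=
  regularNonLiftableAutomorphy_twin_iff_cells.mp (Regular.cells_of_insoluble hI).1

/-- B₂ 27523 ⟹ TA ∧ AL. -/
theorem cells_of_dyadic (hB : MinimalLevelDescent.DyadicLevelOneAutomorphy) :
    TorsionAvatarAutomorphy ∧ AvatarlessResidueAutomorphy :=
  regularNonLiftableAutomorphy_twin_iff_cells.mp (Regular.cells_of_dyadic hB).1

/-- FRAME⁗ from the born route's two other deciding binders (content certificate: FRAME⁗ = route-Langlands-RegularAvatarReduction below REG, through its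
gate-certified `closes`). -/
theorem frame_of_host (hA : RegularAvatarReduction.NoRegularAvatarAutomorphy) (hF : RegularAvatarReduction.NonLiftableResidueFrame) :
    RegularResidueFrame :=
  fun hR => RegularAvatarReduction.closes hR hA hF

/-- FRAME⁗ from the grand-host route-Langlands-NonLiftableResidueReduction rev 0 (LART, NRA, FRAME″ via the twin's `Regular.closes`). -/
theorem frame_of_grandhost (hL : NonLiftableResidueReduction.LiftableResidueAutomorphy) (hA : RegularAvatarReduction.NoRegularAvatarAutomorphy)
    (hF : NonLiftableResidueReduction.InsolubleResidueFrame) : RegularResidueFrame :=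
  fun hR => Regular.closes hL (regularNonLiftableAutomorphy_route_iff_twin.mp hR) (noRegularAvatarAutomorphy_route_iff_twin.mp hA) hF

/-- NECESSITY: Langlands ⟹ FRAME⁗ (trivially: a consequence of S used toward S). -/
theorem frame_of_langlands (hLg : _root_.Langlands) : RegularResidueFrame := fun _ => hLg

/-! ## KERNEL III⁗ — the engine of the residual: AL ⟸ TSR (mod-2 torsion Serre reciprocity makes AL VACUOUS) -/

/-- AL ⟸ TSR: under mod-2 torsion Serre reciprocity no REG-instance lacks a torsion avatar, so AL holds vacuously — the residual automorphy content of
AL is nil; its whole content is an automorphic EXISTENCE statement mod 2 (a torsion class with prescribed Hecke–Frobenius polynomials). -/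
theorem avatarless_of_reciprocity (hS : TorsionSerreReciprocity) : AvatarlessResidueAutomorphy := by
  rw [avatarlessResidueAutomorphy_iff]
  intro K _ _ n hcpt hn ι ρ hirr hins hnl hgeo hreg hlvl hav
  exact absurd ((torsionSerreReciprocity_iff.mp hS) K n hcpt hn ι ρ hirr hins hnl hgeo hreg hlvl) hav

/-- REG ⟸ TA ∧ TSR: «the minimal counterexample to regular non-Artin-residue automorphy may be assumed to HAVE A TORSION AVATAR, granted torsion Serre
reciprocity» — the Calegari–Venkatesh «reciprocity over ℤ» two-step (existence of the torsion class, then lifting it to characteristic 0) at ℓ = 2, level one. -/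
theorem regular_of_torsionAvatar_of_reciprocity (hT : TorsionAvatarAutomorphy) (hS : TorsionSerreReciprocity) :
    RegularAvatarReduction.RegularNonLiftableAutomorphy :=
  regular_of_cells hT (avatarless_of_reciprocity hS)

/-! ## Lines — the TA line (Calegari–Geraghty defect cut) and the AL birth (rank cut), stubs as hypotheses -/

/-- TA ⟸ TA₀ ∧ TA₊ (composition of the BC3 skeleton `line_TA.lean`: defect zero = (n = 2 ∧ K totally real), the Caraiani–Tamiozzo torsion-freeness sector
(ℓ > 2 in print: the dyadic gap), and positive defect, the Calegari–Geraghty sector). -/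
theorem torsionAvatar_of_defects (h0 : ∀ (K : Type) [Field K] [NumberField K] (n : ℕ) (hcpt : Literature.NumberTheory.Automorphic.isCompact_glFiniteIntegralLevel n K), 0 < n → ∀ (ι : PadicAlgCl 2 ≃+* ℂ) (ρ : Literature.NumberTheory.GaloisRepresentations.FramedGaloisRep K (PadicAlgCl 2) n), ρ.toGaloisRep.IsIrreducible → (∀ τ : Field.absoluteGaloisGroup K →* GL (Fin n) (Literature.NumberTheory.GaloisRepresentations.padicAlgClResidueField 2), ρ.IsResidualRepOf (RingHom.id (Literature.NumberTheory.GaloisRepresentations.padicAlgClResidueField 2)) τ → ¬ IsSolvable τ.range) → ¬ (∃ (σ : Literature.NumberTheory.GaloisRepresentations.FramedGaloisRep K (PadicAlgCl 2) n) (τ : Field.absoluteGaloisGroup K →* GL (Fin n) (Literature.NumberTheory.GaloisRepresentations.padicAlgClResidueField 2)), (Set.range (fun g : Field.absoluteGaloisGroup K => σ g)).Finite ∧ σ.toGaloisRep.IsIrreducible ∧ ρ.IsResidualRepOf (RingHom.id (Literature.NumberTheory.GaloisRepresentations.padicAlgClResidueField 2)) τ ∧ σ.IsResidualRepOf (RingHom.id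 (Literature.NumberTheory.GaloisRepresentations.padicAlgClResidueField 2)) τ) → ((∀ᶠ v : IsDedekindDomain.HeightOneSpectrum (NumberField.RingOfIntegers K) in cofinite, ρ.IsUnramifiedAt v) ∧ ∀ (v : IsDedekindDomain.HeightOneSpectrum (NumberField.RingOfIntegers K)) (hv : ((2 : ℕ) : NumberField.RingOfIntegers K) ∈ v.asIdeal), (Literature.NumberTheory.PAdicHodge.fontainePstAdicCompletion v 2 hv).IsDeRhamFramed (ρ.toLocal v)) → (∀ (v : IsDedekindDomain.HeightOneSpectrum (NumberField.RingOfIntegers K)) (hv : ((2 : ℕ) : NumberField.RingOfIntegers K) ∈ v.asIdeal), ∀ e : v.adicCompletion K →+* PadicAlgCl 2, Continuous e → (ρ.labelledHodgeTateWeightsAt v (Literature.NumberTheory.PAdicHodge.fontainePstAdicCompletion v 2 hv).algebra (Literature.NumberTheory.PAdicHodge.fontainePstAdicCompletion v 2 hv).𝔅 e).Nodup) → (∀ v : IsDedekindDomain.HeightOneSpectrum (NumberField.RingOfIntegers K), ((2 : ℕ) : NumberField.RingOfIntegers K) ∉ v.asIdeal → ρ.IsUnramifiedAt v) → (n = 2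 ∧ NumberField.IsTotallyReal K) → (letI : TopologicalSpace (Literature.NumberTheory.GaloisRepresentations.padicAlgClResidueField 2) := ⊥; ∃ τ : Literature.NumberTheory.GaloisRepresentations.FramedGaloisRep K (Literature.NumberTheory.GaloisRepresentations.padicAlgClResidueField 2) n, ρ.IsReductionOf (RingHom.id (Literature.NumberTheory.GaloisRepresentations.padicAlgClResidueField 2)) (τ : Field.absoluteGaloisGroup K →* GL (Fin n) (Literature.NumberTheory.GaloisRepresentations.padicAlgClResidueField 2)) ∧ (Literature.NumberTheory.Automorphic.BigHeckeGLn.TameLevel.full n K 2).IsPadicallyAutomorphic τ) → ∃ π : Literature.NumberTheory.Automorphic.CuspidalAutomorphicRepData n K hcpt, π.1.IsLAlgebraic ∧ ∀ᶠ v : IsDedekindDomain.HeightOneSpectrum (NumberField.RingOfIntegers K) in cofinite, ρ.IsUnramifiedAt v ∧ (∃ α : Multiset ℂ, π.1.HasSatakeParamAt v α) ∧ ∀ α : Multiset ℂ, π.1.HasSatakeParamAt v α → ∃ P Q : Polynomial (Valued.v : Valuation (PadicAlgCl 2) NNReal).valuationSubring, ρ.HasFrobCharpolyAt v (P.map (Valued.v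 : Valuation (PadicAlgCl 2) NNReal).valuationSubring.subtype) ∧ Literature.NumberTheory.Automorphic.arithFrobPolyOfSatake ι v.residueCard 1 α = Q.map (Valued.v : Valuation (PadicAlgCl 2) NNReal).valuationSubring.subtype ∧ P.map (IsLocalRing.residue (Valued.v : Valuation (PadicAlgCl 2) NNReal).valuationSubring) = Q.map (IsLocalRing.residue (Valued.v : Valuation (PadicAlgCl 2) NNReal).valuationSubring)) (h1 : ∀ (K : Type) [Field K] [NumberField K] (n : ℕ) (hcpt : Literature.NumberTheory.Automorphic.isCompact_glFiniteIntegralLevel n K), 0 < n → ∀ (ι : PadicAlgCl 2 ≃+* ℂ) (ρ : Literature.NumberTheory.GaloisRepresentations.FramedGaloisRep K (PadicAlgCl 2) n), ρ.toGaloisRep.IsIrreducible → (∀ τ : Field.absoluteGaloisGroup K →* GL (Fin n) (Literature.NumberTheory.GaloisRepresentations.padicAlgClResidueField 2), ρ.IsResidualRepOf (RingHom.id (Literature.NumberTheory.GaloisRepresentations.padicAlgClResidueField 2)) τ → ¬ IsSolvable τ.range) → ¬ (∃ (σ : Literature.NumberTheory.GaloisRepresentations.FramedGaloisRep K (PadicAlgCl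 2) n) (τ : Field.absoluteGaloisGroup K →* GL (Fin n) (Literature.NumberTheory.GaloisRepresentations.padicAlgClResidueField 2)), (Set.range (fun g : Field.absoluteGaloisGroup K => σ g)).Finite ∧ σ.toGaloisRep.IsIrreducible ∧ ρ.IsResidualRepOf (RingHom.id (Literature.NumberTheory.GaloisRepresentations.padicAlgClResidueField 2)) τ ∧ σ.IsResidualRepOf (RingHom.id (Literature.NumberTheory.GaloisRepresentations.padicAlgClResidueField 2)) τ) → ((∀ᶠ v : IsDedekindDomain.HeightOneSpectrum (NumberField.RingOfIntegers K) in cofinite, ρ.IsUnramifiedAt v) ∧ ∀ (v : IsDedekindDomain.HeightOneSpectrum (NumberField.RingOfIntegers K)) (hv : ((2 : ℕ) : NumberField.RingOfIntegers K) ∈ v.asIdeal), (Literature.NumberTheory.PAdicHodge.fontainePstAdicCompletion v 2 hv).IsDeRhamFramed (ρ.toLocal v)) → (∀ (v : IsDedekindDomain.HeightOneSpectrum (NumberField.RingOfIntegers K)) (hv : ((2 : ℕ) : NumberField.RingOfIntegers K) ∈ v.asIdeal), ∀ e : v.adicCompletion K →+* PadicAlgCl 2, Continuous e → (ρ.labelledHodgeTateWeightsAt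 v (Literature.NumberTheory.PAdicHodge.fontainePstAdicCompletion v 2 hv).algebra (Literature.NumberTheory.PAdicHodge.fontainePstAdicCompletion v 2 hv).𝔅 e).Nodup) → (∀ v : IsDedekindDomain.HeightOneSpectrum (NumberField.RingOfIntegers K), ((2 : ℕ) : NumberField.RingOfIntegers K) ∉ v.asIdeal → ρ.IsUnramifiedAt v) → ¬ (n = 2 ∧ NumberField.IsTotallyReal K) → (letI : TopologicalSpace (Literature.NumberTheory.GaloisRepresentations.padicAlgClResidueField 2) := ⊥; ∃ τ : Literature.NumberTheory.GaloisRepresentations.FramedGaloisRep K (Literature.NumberTheory.GaloisRepresentations.padicAlgClResidueField 2) n, ρ.IsReductionOf (RingHom.id (Literature.NumberTheory.GaloisRepresentations.padicAlgClResidueField 2)) (τ : Field.absoluteGaloisGroup K →* GL (Fin n) (Literature.NumberTheory.GaloisRepresentations.padicAlgClResidueField 2)) ∧ (Literature.NumberTheory.Automorphic.BigHeckeGLn.TameLevel.full n K 2).IsPadicallyAutomorphic τ) → ∃ π : Literature.NumberTheory.Automorphic.CuspidalAutomorphicRepData n K hcpt, π.1.IsLAlgebraic ∧ ∀ᶠ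 v : IsDedekindDomain.HeightOneSpectrum (NumberField.RingOfIntegers K) in cofinite, ρ.IsUnramifiedAt v ∧ (∃ α : Multiset ℂ, π.1.HasSatakeParamAt v α) ∧ ∀ α : Multiset ℂ, π.1.HasSatakeParamAt v α → ∃ P Q : Polynomial (Valued.v : Valuation (PadicAlgCl 2) NNReal).valuationSubring, ρ.HasFrobCharpolyAt v (P.map (Valued.v : Valuation (PadicAlgCl 2) NNReal).valuationSubring.subtype) ∧ Literature.NumberTheory.Automorphic.arithFrobPolyOfSatake ι v.residueCard 1 α = Q.map (Valued.v : Valuation (PadicAlgCl 2) NNReal).valuationSubring.subtype ∧ P.map (IsLocalRing.residue (Valued.v : Valuation (PadicAlgCl 2) NNReal).valuationSubring) = Q.map (IsLocalRing.residue (Valued.v : Valuation (PadicAlgCl 2) NNReal).valuationSubring)) : TorsionAvatarAutomorphy := by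
  intro K _ _ n hcpt hn ι ρ hirr hins hnl hgeo hreg hlvl hav
  by_cases hd : (n = 2 ∧ NumberField.IsTotallyReal K)
  · exact h0 K n hcpt hn ι ρ hirr hins hnl hgeo hreg hlvl hd hav
  · exact h1 K n hcpt hn ι ρ hirr hins hnl hgeo hreg hlvl hd hav

/-- The two TA line stubs are S-implied (TA restricted by defect). [kernel certificate] -/
theorem lineStubs_of_langlands (hLg : _root_.Langlands) : (∀ (K : Type) [Field K] [NumberField K] (n : ℕ) (hcpt : Literature.NumberTheory.Automorphic.isCompact_glFiniteIntegralLevel n K), 0 < n → ∀ (ι : PadicAlgCl 2 ≃+* ℂ) (ρ : Literature.NumberTheory.GaloisRepresentations.FramedGaloisRep K (PadicAlgCl 2) n), ρ.toGaloisRep.IsIrreducible → (∀ τ : Field.absoluteGaloisGroup K →* GL (Fin n) (Literature.NumberTheory.GaloisRepresentations.padicAlgClResidueField 2), ρ.IsResidualRepOf (RingHom.id (Literature.NumberTheory.GaloisRepresentations.padicAlgClResidueField 2)) τ → ¬ IsSolvable τ.range) → ¬ (∃ (σ : Literature.NumberTheory.GaloisRepresentations.FramedGaloisRep K (PadicAlgCl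 2) n) (τ : Field.absoluteGaloisGroup K →* GL (Fin n) (Literature.NumberTheory.GaloisRepresentations.padicAlgClResidueField 2)), (Set.range (fun g : Field.absoluteGaloisGroup K => σ g)).Finite ∧ σ.toGaloisRep.IsIrreducible ∧ ρ.IsResidualRepOf (RingHom.id (Literature.NumberTheory.GaloisRepresentations.padicAlgClResidueField 2)) τ ∧ σ.IsResidualRepOf (RingHom.id (Literature.NumberTheory.GaloisRepresentations.padicAlgClResidueField 2)) τ) → ((∀ᶠ v : IsDedekindDomain.HeightOneSpectrum (NumberField.RingOfIntegers K) in cofinite, ρ.IsUnramifiedAt v) ∧ ∀ (v : IsDedekindDomain.HeightOneSpectrum (NumberField.RingOfIntegers K)) (hv : ((2 : ℕ) : NumberField.RingOfIntegers K) ∈ v.asIdeal), (Literature.NumberTheory.PAdicHodge.fontainePstAdicCompletion v 2 hv).IsDeRhamFramed (ρ.toLocal v)) → (∀ (v : IsDedekindDomain.HeightOneSpectrum (NumberField.RingOfIntegers K)) (hv : ((2 : ℕ) : NumberField.RingOfIntegers K) ∈ v.asIdeal), ∀ e : v.adicCompletion K →+* PadicAlgCl 2, Continuous e → (ρ.labelledHodgeTateWeightsAt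 v (Literature.NumberTheory.PAdicHodge.fontainePstAdicCompletion v 2 hv).algebra (Literature.NumberTheory.PAdicHodge.fontainePstAdicCompletion v 2 hv).𝔅 e).Nodup) → (∀ v : IsDedekindDomain.HeightOneSpectrum (NumberField.RingOfIntegers K), ((2 : ℕ) : NumberField.RingOfIntegers K) ∉ v.asIdeal → ρ.IsUnramifiedAt v) → (n = 2 ∧ NumberField.IsTotallyReal K) → (letI : TopologicalSpace (Literature.NumberTheory.GaloisRepresentations.padicAlgClResidueField 2) := ⊥; ∃ τ : Literature.NumberTheory.GaloisRepresentations.FramedGaloisRep K (Literature.NumberTheory.GaloisRepresentations.padicAlgClResidueField 2) n, ρ.IsReductionOf (RingHom.id (Literature.NumberTheory.GaloisRepresentations.padicAlgClResidueField 2)) (τ : Field.absoluteGaloisGroup K →* GL (Fin n) (Literature.NumberTheory.GaloisRepresentations.padicAlgClResidueField 2)) ∧ (Literature.NumberTheory.Automorphic.BigHeckeGLn.TameLevel.full n K 2).IsPadicallyAutomorphic τ) → ∃ π : Literature.NumberTheory.Automorphic.CuspidalAutomorphicRepData n K hcpt, π.1.IsLAlgebraic ∧ ∀ᶠ v : IsDedekindDomain.HeightOneSpectrum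 (NumberField.RingOfIntegers K) in cofinite, ρ.IsUnramifiedAt v ∧ (∃ α : Multiset ℂ, π.1.HasSatakeParamAt v α) ∧ ∀ α : Multiset ℂ, π.1.HasSatakeParamAt v α → ∃ P Q : Polynomial (Valued.v : Valuation (PadicAlgCl 2) NNReal).valuationSubring, ρ.HasFrobCharpolyAt v (P.map (Valued.v : Valuation (PadicAlgCl 2) NNReal).valuationSubring.subtype) ∧ Literature.NumberTheory.Automorphic.arithFrobPolyOfSatake ι v.residueCard 1 α = Q.map (Valued.v : Valuation (PadicAlgCl 2) NNReal).valuationSubring.subtype ∧ P.map (IsLocalRing.residue (Valued.v : Valuation (PadicAlgCl 2) NNReal).valuationSubring) = Q.map (IsLocalRing.residue (Valued.v : Valuation (PadicAlgCl 2) NNReal).valuationSubring)) ∧ (∀ (K : Type) [Field K] [NumberField K] (n : ℕ) (hcpt : Literature.NumberTheory.Automorphic.isCompact_glFiniteIntegralLevel n K), 0 < n → ∀ (ι : PadicAlgCl 2 ≃+* ℂ) (ρ : Literature.NumberTheory.GaloisRepresentations.FramedGaloisRep K (PadicAlgCl 2) n), ρ.toGaloisRep.IsIrreducible → (∀ τ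 : Field.absoluteGaloisGroup K →* GL (Fin n) (Literature.NumberTheory.GaloisRepresentations.padicAlgClResidueField 2), ρ.IsResidualRepOf (RingHom.id (Literature.NumberTheory.GaloisRepresentations.padicAlgClResidueField 2)) τ → ¬ IsSolvable τ.range) → ¬ (∃ (σ : Literature.NumberTheory.GaloisRepresentations.FramedGaloisRep K (PadicAlgCl 2) n) (τ : Field.absoluteGaloisGroup K →* GL (Fin n) (Literature.NumberTheory.GaloisRepresentations.padicAlgClResidueField 2)), (Set.range (fun g : Field.absoluteGaloisGroup K => σ g)).Finite ∧ σ.toGaloisRep.IsIrreducible ∧ ρ.IsResidualRepOf (RingHom.id (Literature.NumberTheory.GaloisRepresentations.padicAlgClResidueField 2)) τ ∧ σ.IsResidualRepOf (RingHom.id (Literature.NumberTheory.GaloisRepresentations.padicAlgClResidueField 2)) τ) → ((∀ᶠ v : IsDedekindDomain.HeightOneSpectrum (NumberField.RingOfIntegers K) in cofinite, ρ.IsUnramifiedAt v) ∧ ∀ (v : IsDedekindDomain.HeightOneSpectrum (NumberField.RingOfIntegers K)) (hv : ((2 : ℕ) : NumberField.RingOfIntegers K) ∈ v.asIdeal), (Literature.NumberTheory.PAdicHodge.fontainePstAdicCompletion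 v 2 hv).IsDeRhamFramed (ρ.toLocal v)) → (∀ (v : IsDedekindDomain.HeightOneSpectrum (NumberField.RingOfIntegers K)) (hv : ((2 : ℕ) : NumberField.RingOfIntegers K) ∈ v.asIdeal), ∀ e : v.adicCompletion K →+* PadicAlgCl 2, Continuous e → (ρ.labelledHodgeTateWeightsAt v (Literature.NumberTheory.PAdicHodge.fontainePstAdicCompletion v 2 hv).algebra (Literature.NumberTheory.PAdicHodge.fontainePstAdicCompletion v 2 hv).𝔅 e).Nodup) → (∀ v : IsDedekindDomain.HeightOneSpectrum (NumberField.RingOfIntegers K), ((2 : ℕ) : NumberField.RingOfIntegers K) ∉ v.asIdeal → ρ.IsUnramifiedAt v) → ¬ (n = 2 ∧ NumberField.IsTotallyReal K) → (letI : TopologicalSpace (Literature.NumberTheory.GaloisRepresentations.padicAlgClResidueField 2) := ⊥; ∃ τ : Literature.NumberTheory.GaloisRepresentations.FramedGaloisRep K (Literature.NumberTheory.GaloisRepresentations.padicAlgClResidueField 2) n, ρ.IsReductionOf (RingHom.id (Literature.NumberTheory.GaloisRepresentations.padicAlgClResidueField 2)) (τ : Field.absoluteGaloisGroup K →* GL (Fin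 n) (Literature.NumberTheory.GaloisRepresentations.padicAlgClResidueField 2)) ∧ (Literature.NumberTheory.Automorphic.BigHeckeGLn.TameLevel.full n K 2).IsPadicallyAutomorphic τ) → ∃ π : Literature.NumberTheory.Automorphic.CuspidalAutomorphicRepData n K hcpt, π.1.IsLAlgebraic ∧ ∀ᶠ v : IsDedekindDomain.HeightOneSpectrum (NumberField.RingOfIntegers K) in cofinite, ρ.IsUnramifiedAt v ∧ (∃ α : Multiset ℂ, π.1.HasSatakeParamAt v α) ∧ ∀ α : Multiset ℂ, π.1.HasSatakeParamAt v α → ∃ P Q : Polynomial (Valued.v : Valuation (PadicAlgCl 2) NNReal).valuationSubring, ρ.HasFrobCharpolyAt v (P.map (Valued.v : Valuation (PadicAlgCl 2) NNReal).valuationSubring.subtype) ∧ Literature.NumberTheory.Automorphic.arithFrobPolyOfSatake ι v.residueCard 1 α = Q.map (Valued.v : Valuation (PadicAlgCl 2) NNReal).valuationSubring.subtype ∧ P.map (IsLocalRing.residue (Valued.v : Valuation (PadicAlgCl 2) NNReal).valuationSubring) = Q.map (IsLocalRing.residue (Valued.v : Valuation (PadicAlgCl 2) NNReal).valuationSubring))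 :=
  ⟨fun K _ _ n hcpt hn ι ρ hirr hins hnl hgeo hreg hlvl _ hav => torsionAvatar_of_langlands hLg K n hcpt hn ι ρ hirr hins hnl hgeo hreg hlvl hav,
   fun K _ _ n hcpt hn ι ρ hirr hins hnl hgeo hreg hlvl _ hav => torsionAvatar_of_langlands hLg K n hcpt hn ι ρ hirr hins hnl hgeo hreg hlvl hav⟩

/-- AL ⟸ AL≤2 ∧ AL≥3 (composition of the birth skeleton `birth_AL.lean`: rank cut). -/
theorem avatarless_of_ranks (h2 : ∀ (K : Type) [Field K] [NumberField K] (n : ℕ) (hcpt : Literature.NumberTheory.Automorphic.isCompact_glFiniteIntegralLevel n K), 0 < n → ∀ (ι : PadicAlgCl 2 ≃+* ℂ) (ρ : Literature.NumberTheory.GaloisRepresentations.FramedGaloisRep K (PadicAlgCl 2) n), ρ.toGaloisRep.IsIrreducible → (∀ τ : Field.absoluteGaloisGroup K →* GL (Fin n) (Literature.NumberTheory.GaloisRepresentations.padicAlgClResidueField 2), ρ.IsResidualRepOf (RingHom.id (Literature.NumberTheory.GaloisRepresentations.padicAlgClResidueField 2)) τ → ¬ IsSolvable τ.range) → ¬ (∃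 (σ : Literature.NumberTheory.GaloisRepresentations.FramedGaloisRep K (PadicAlgCl 2) n) (τ : Field.absoluteGaloisGroup K →* GL (Fin n) (Literature.NumberTheory.GaloisRepresentations.padicAlgClResidueField 2)), (Set.range (fun g : Field.absoluteGaloisGroup K => σ g)).Finite ∧ σ.toGaloisRep.IsIrreducible ∧ ρ.IsResidualRepOf (RingHom.id (Literature.NumberTheory.GaloisRepresentations.padicAlgClResidueField 2)) τ ∧ σ.IsResidualRepOf (RingHom.id (Literature.NumberTheory.GaloisRepresentations.padicAlgClResidueField 2)) τ) → ((∀ᶠ v : IsDedekindDomain.HeightOneSpectrum (NumberField.RingOfIntegers K) in cofinite, ρ.IsUnramifiedAt v) ∧ ∀ (v : IsDedekindDomain.HeightOneSpectrum (NumberField.RingOfIntegers K)) (hv : ((2 : ℕ) : NumberField.RingOfIntegers K) ∈ v.asIdeal), (Literature.NumberTheory.PAdicHodge.fontainePstAdicCompletion v 2 hv).IsDeRhamFramed (ρ.toLocal v)) → (∀ (v : IsDedekindDomain.HeightOneSpectrum (NumberField.RingOfIntegers K)) (hv : ((2 : ℕ) : NumberField.RingOfIntegers K) ∈ v.asIdeal),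 ∀ e : v.adicCompletion K →+* PadicAlgCl 2, Continuous e → (ρ.labelledHodgeTateWeightsAt v (Literature.NumberTheory.PAdicHodge.fontainePstAdicCompletion v 2 hv).algebra (Literature.NumberTheory.PAdicHodge.fontainePstAdicCompletion v 2 hv).𝔅 e).Nodup) → (∀ v : IsDedekindDomain.HeightOneSpectrum (NumberField.RingOfIntegers K), ((2 : ℕ) : NumberField.RingOfIntegers K) ∉ v.asIdeal → ρ.IsUnramifiedAt v) → n ≤ 2 → ¬ (letI : TopologicalSpace (Literature.NumberTheory.GaloisRepresentations.padicAlgClResidueField 2) := ⊥; ∃ τ : Literature.NumberTheory.GaloisRepresentations.FramedGaloisRep K (Literature.NumberTheory.GaloisRepresentations.padicAlgClResidueField 2) n, ρ.IsReductionOf (RingHom.id (Literature.NumberTheory.GaloisRepresentations.padicAlgClResidueField 2)) (τ : Field.absoluteGaloisGroup K →* GL (Fin n) (Literature.NumberTheory.GaloisRepresentations.padicAlgClResidueField 2)) ∧ (Literature.NumberTheory.Automorphic.BigHeckeGLn.TameLevel.full n K 2).IsPadicallyAutomorphic τ) → ∃ π : Literature.NumberTheory.Automorphic.CuspidalAutomorphicRepData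 n K hcpt, π.1.IsLAlgebraic ∧ ∀ᶠ v : IsDedekindDomain.HeightOneSpectrum (NumberField.RingOfIntegers K) in cofinite, ρ.IsUnramifiedAt v ∧ (∃ α : Multiset ℂ, π.1.HasSatakeParamAt v α) ∧ ∀ α : Multiset ℂ, π.1.HasSatakeParamAt v α → ∃ P Q : Polynomial (Valued.v : Valuation (PadicAlgCl 2) NNReal).valuationSubring, ρ.HasFrobCharpolyAt v (P.map (Valued.v : Valuation (PadicAlgCl 2) NNReal).valuationSubring.subtype) ∧ Literature.NumberTheory.Automorphic.arithFrobPolyOfSatake ι v.residueCard 1 α = Q.map (Valued.v : Valuation (PadicAlgCl 2) NNReal).valuationSubring.subtype ∧ P.map (IsLocalRing.residue (Valued.v : Valuation (PadicAlgCl 2) NNReal).valuationSubring) = Q.map (IsLocalRing.residue (Valued.v : Valuation (PadicAlgCl 2) NNReal).valuationSubring)) (h3 : ∀ (K : Type) [Field K] [NumberField K] (n : ℕ) (hcpt : Literature.NumberTheory.Automorphic.isCompact_glFiniteIntegralLevel n K), 0 < n → ∀ (ι : PadicAlgCl 2 ≃+* ℂ) (ρ : Literature.NumberTheory.GaloisRepresentations.FramedGaloisRep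 K (PadicAlgCl 2) n), ρ.toGaloisRep.IsIrreducible → (∀ τ : Field.absoluteGaloisGroup K →* GL (Fin n) (Literature.NumberTheory.GaloisRepresentations.padicAlgClResidueField 2), ρ.IsResidualRepOf (RingHom.id (Literature.NumberTheory.GaloisRepresentations.padicAlgClResidueField 2)) τ → ¬ IsSolvable τ.range) → ¬ (∃ (σ : Literature.NumberTheory.GaloisRepresentations.FramedGaloisRep K (PadicAlgCl 2) n) (τ : Field.absoluteGaloisGroup K →* GL (Fin n) (Literature.NumberTheory.GaloisRepresentations.padicAlgClResidueField 2)), (Set.range (fun g : Field.absoluteGaloisGroup K => σ g)).Finite ∧ σ.toGaloisRep.IsIrreducible ∧ ρ.IsResidualRepOf (RingHom.id (Literature.NumberTheory.GaloisRepresentations.padicAlgClResidueField 2)) τ ∧ σ.IsResidualRepOf (RingHom.id (Literature.NumberTheory.GaloisRepresentations.padicAlgClResidueField 2)) τ) → ((∀ᶠ v : IsDedekindDomain.HeightOneSpectrum (NumberField.RingOfIntegers K) in cofinite, ρ.IsUnramifiedAt v) ∧ ∀ (v : IsDedekindDomain.HeightOneSpectrum (NumberField.RingOfIntegers K)) (hv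 : ((2 : ℕ) : NumberField.RingOfIntegers K) ∈ v.asIdeal), (Literature.NumberTheory.PAdicHodge.fontainePstAdicCompletion v 2 hv).IsDeRhamFramed (ρ.toLocal v)) → (∀ (v : IsDedekindDomain.HeightOneSpectrum (NumberField.RingOfIntegers K)) (hv : ((2 : ℕ) : NumberField.RingOfIntegers K) ∈ v.asIdeal), ∀ e : v.adicCompletion K →+* PadicAlgCl 2, Continuous e → (ρ.labelledHodgeTateWeightsAt v (Literature.NumberTheory.PAdicHodge.fontainePstAdicCompletion v 2 hv).algebra (Literature.NumberTheory.PAdicHodge.fontainePstAdicCompletion v 2 hv).𝔅 e).Nodup) → (∀ v : IsDedekindDomain.HeightOneSpectrum (NumberField.RingOfIntegers K), ((2 : ℕ) : NumberField.RingOfIntegers K) ∉ v.asIdeal → ρ.IsUnramifiedAt v) → 3 ≤ n → ¬ (letI : TopologicalSpace (Literature.NumberTheory.GaloisRepresentations.padicAlgClResidueField 2) := ⊥; ∃ τ : Literature.NumberTheory.GaloisRepresentations.FramedGaloisRep K (Literature.NumberTheory.GaloisRepresentations.padicAlgClResidueField 2) n, ρ.IsReductionOf (RingHom.id (Literature.NumberTheory.GaloisRepresentations.padicAlgClResidueField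 2)) (τ : Field.absoluteGaloisGroup K →* GL (Fin n) (Literature.NumberTheory.GaloisRepresentations.padicAlgClResidueField 2)) ∧ (Literature.NumberTheory.Automorphic.BigHeckeGLn.TameLevel.full n K 2).IsPadicallyAutomorphic τ) → ∃ π : Literature.NumberTheory.Automorphic.CuspidalAutomorphicRepData n K hcpt, π.1.IsLAlgebraic ∧ ∀ᶠ v : IsDedekindDomain.HeightOneSpectrum (NumberField.RingOfIntegers K) in cofinite, ρ.IsUnramifiedAt v ∧ (∃ α : Multiset ℂ, π.1.HasSatakeParamAt v α) ∧ ∀ α : Multiset ℂ, π.1.HasSatakeParamAt v α → ∃ P Q : Polynomial (Valued.v : Valuation (PadicAlgCl 2) NNReal).valuationSubring, ρ.HasFrobCharpolyAt v (P.map (Valued.v : Valuation (PadicAlgCl 2) NNReal).valuationSubring.subtype) ∧ Literature.NumberTheory.Automorphic.arithFrobPolyOfSatake ι v.residueCard 1 α = Q.map (Valued.v : Valuation (PadicAlgCl 2) NNReal).valuationSubring.subtype ∧ P.map (IsLocalRing.residue (Valued.v : Valuation (PadicAlgCl 2) NNReal).valuationSubring) = Q.map (IsLocalRing.residue (Valued.v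 : Valuation (PadicAlgCl 2) NNReal).valuationSubring)) : AvatarlessResidueAutomorphy := by
  intro K _ _ n hcpt hn ι ρ hirr hins hnl hgeo hreg hlvl hav
  rcases Nat.lt_or_ge n 3 with h | h
  · exact h2 K n hcpt hn ι ρ hirr hins hnl hgeo hreg hlvl (by omega) hav
  · exact h3 K n hcpt hn ι ρ hirr hins hnl hgeo hreg hlvl h hav

/-- AL ⟸ TSR≤2 ∧ AL≥3: in rank ≤ 2 the load-bearing stub is torsion Serre reciprocity (Buzzard–Diamond–Jarvis / Figueiredo / Şengün–Torrey-type mod-2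
reciprocity for GL₂ over K), under which AL≤2 is vacuous; rank ≥ 3 is AL itself there (Ash–Doud–Pollack / Herzig range, K = ℚ only in print). -/
theorem avatarless_of_serreRankTwo (hS : ∀ (K : Type) [Field K] [NumberField K] (n : ℕ) (hcpt : Literature.NumberTheory.Automorphic.isCompact_glFiniteIntegralLevel n K), 0 < n → ∀ (ι : PadicAlgCl 2 ≃+* ℂ) (ρ : Literature.NumberTheory.GaloisRepresentations.FramedGaloisRep K (PadicAlgCl 2) n), ρ.toGaloisRep.IsIrreducible → (∀ τ : Field.absoluteGaloisGroup K →* GL (Fin n) (Literature.NumberTheory.GaloisRepresentations.padicAlgClResidueField 2), ρ.IsResidualRepOf (RingHom.id (Literature.NumberTheory.GaloisRepresentations.padicAlgClResidueField 2)) τ → ¬ IsSolvable τ.range) → ¬ (∃ (σ : Literature.NumberTheory.GaloisRepresentations.FramedGaloisRep K (PadicAlgCl 2) n) (τ : Field.absoluteGaloisGroup K →* GL (Fin n) (Literature.NumberTheory.GaloisRepresentations.padicAlgClResidueField 2)), (Set.range (fun g : Field.absoluteGaloisGroup K => σ g)).Finite ∧ σ.toGaloisRep.IsIrreducible ∧ ρ.IsResidualRepOf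 (RingHom.id (Literature.NumberTheory.GaloisRepresentations.padicAlgClResidueField 2)) τ ∧ σ.IsResidualRepOf (RingHom.id (Literature.NumberTheory.GaloisRepresentations.padicAlgClResidueField 2)) τ) → ((∀ᶠ v : IsDedekindDomain.HeightOneSpectrum (NumberField.RingOfIntegers K) in cofinite, ρ.IsUnramifiedAt v) ∧ ∀ (v : IsDedekindDomain.HeightOneSpectrum (NumberField.RingOfIntegers K)) (hv : ((2 : ℕ) : NumberField.RingOfIntegers K) ∈ v.asIdeal), (Literature.NumberTheory.PAdicHodge.fontainePstAdicCompletion v 2 hv).IsDeRhamFramed (ρ.toLocal v)) → (∀ (v : IsDedekindDomain.HeightOneSpectrum (NumberField.RingOfIntegers K)) (hv : ((2 : ℕ) : NumberField.RingOfIntegers K) ∈ v.asIdeal), ∀ e : v.adicCompletion K →+* PadicAlgCl 2, Continuous e → (ρ.labelledHodgeTateWeightsAt v (Literature.NumberTheory.PAdicHodge.fontainePstAdicCompletion v 2 hv).algebra (Literature.NumberTheory.PAdicHodge.fontainePstAdicCompletion v 2 hv).𝔅 e).Nodup) → (∀ v : IsDedekindDomain.HeightOneSpectrum (NumberField.RingOfIntegers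 K), ((2 : ℕ) : NumberField.RingOfIntegers K) ∉ v.asIdeal → ρ.IsUnramifiedAt v) → n ≤ 2 → (letI : TopologicalSpace (Literature.NumberTheory.GaloisRepresentations.padicAlgClResidueField 2) := ⊥; ∃ τ : Literature.NumberTheory.GaloisRepresentations.FramedGaloisRep K (Literature.NumberTheory.GaloisRepresentations.padicAlgClResidueField 2) n, ρ.IsReductionOf (RingHom.id (Literature.NumberTheory.GaloisRepresentations.padicAlgClResidueField 2)) (τ : Field.absoluteGaloisGroup K →* GL (Fin n) (Literature.NumberTheory.GaloisRepresentations.padicAlgClResidueField 2)) ∧ (Literature.NumberTheory.Automorphic.BigHeckeGLn.TameLevel.full n K 2).IsPadicallyAutomorphic τ)) (h3 : ∀ (K : Type) [Field K] [NumberField K] (n : ℕ) (hcpt : Literature.NumberTheory.Automorphic.isCompact_glFiniteIntegralLevel n K), 0 < n → ∀ (ι : PadicAlgCl 2 ≃+* ℂ) (ρ : Literature.NumberTheory.GaloisRepresentations.FramedGaloisRep K (PadicAlgCl 2) n), ρ.toGaloisRep.IsIrreducible → (∀ τ : Field.absoluteGaloisGroup K →* GL (Fin n) (Literature.NumberTheory.GaloisRepresentations.padicAlgClResidueField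 2), ρ.IsResidualRepOf (RingHom.id (Literature.NumberTheory.GaloisRepresentations.padicAlgClResidueField 2)) τ → ¬ IsSolvable τ.range) → ¬ (∃ (σ : Literature.NumberTheory.GaloisRepresentations.FramedGaloisRep K (PadicAlgCl 2) n) (τ : Field.absoluteGaloisGroup K →* GL (Fin n) (Literature.NumberTheory.GaloisRepresentations.padicAlgClResidueField 2)), (Set.range (fun g : Field.absoluteGaloisGroup K => σ g)).Finite ∧ σ.toGaloisRep.IsIrreducible ∧ ρ.IsResidualRepOf (RingHom.id (Literature.NumberTheory.GaloisRepresentations.padicAlgClResidueField 2)) τ ∧ σ.IsResidualRepOf (RingHom.id (Literature.NumberTheory.GaloisRepresentations.padicAlgClResidueField 2)) τ) → ((∀ᶠ v : IsDedekindDomain.HeightOneSpectrum (NumberField.RingOfIntegers K) in cofinite, ρ.IsUnramifiedAt v) ∧ ∀ (v : IsDedekindDomain.HeightOneSpectrum (NumberField.RingOfIntegers K)) (hv : ((2 : ℕ) : NumberField.RingOfIntegers K) ∈ v.asIdeal), (Literature.NumberTheory.PAdicHodge.fontainePstAdicCompletion v 2 hv).IsDeRhamFramed (ρ.toLocal v))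 → (∀ (v : IsDedekindDomain.HeightOneSpectrum (NumberField.RingOfIntegers K)) (hv : ((2 : ℕ) : NumberField.RingOfIntegers K) ∈ v.asIdeal), ∀ e : v.adicCompletion K →+* PadicAlgCl 2, Continuous e → (ρ.labelledHodgeTateWeightsAt v (Literature.NumberTheory.PAdicHodge.fontainePstAdicCompletion v 2 hv).algebra (Literature.NumberTheory.PAdicHodge.fontainePstAdicCompletion v 2 hv).𝔅 e).Nodup) → (∀ v : IsDedekindDomain.HeightOneSpectrum (NumberField.RingOfIntegers K), ((2 : ℕ) : NumberField.RingOfIntegers K) ∉ v.asIdeal → ρ.IsUnramifiedAt v) → 3 ≤ n → ¬ (letI : TopologicalSpace (Literature.NumberTheory.GaloisRepresentations.padicAlgClResidueField 2) := ⊥; ∃ τ : Literature.NumberTheory.GaloisRepresentations.FramedGaloisRep K (Literature.NumberTheory.GaloisRepresentations.padicAlgClResidueField 2) n, ρ.IsReductionOf (RingHom.id (Literature.NumberTheory.GaloisRepresentations.padicAlgClResidueField 2)) (τ : Field.absoluteGaloisGroup K →* GL (Fin n) (Literature.NumberTheory.GaloisRepresentations.padicAlgClResidueField 2)) ∧ (Literature.NumberTheory.Automorphic.BigHeckeGLn.TameLevel.full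 n K 2).IsPadicallyAutomorphic τ) → ∃ π : Literature.NumberTheory.Automorphic.CuspidalAutomorphicRepData n K hcpt, π.1.IsLAlgebraic ∧ ∀ᶠ v : IsDedekindDomain.HeightOneSpectrum (NumberField.RingOfIntegers K) in cofinite, ρ.IsUnramifiedAt v ∧ (∃ α : Multiset ℂ, π.1.HasSatakeParamAt v α) ∧ ∀ α : Multiset ℂ, π.1.HasSatakeParamAt v α → ∃ P Q : Polynomial (Valued.v : Valuation (PadicAlgCl 2) NNReal).valuationSubring, ρ.HasFrobCharpolyAt v (P.map (Valued.v : Valuation (PadicAlgCl 2) NNReal).valuationSubring.subtype) ∧ Literature.NumberTheory.Automorphic.arithFrobPolyOfSatake ι v.residueCard 1 α = Q.map (Valued.v : Valuation (PadicAlgCl 2) NNReal).valuationSubring.subtype ∧ P.map (IsLocalRing.residue (Valued.v : Valuation (PadicAlgCl 2) NNReal).valuationSubring) = Q.map (IsLocalRing.residue (Valued.v : Valuation (PadicAlgCl 2) NNReal).valuationSubring)) : AvatarlessResidueAutomorphy := by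
  intro K _ _ n hcpt hn ι ρ hirr hins hnl hgeo hreg hlvl hav
  rcases Nat.lt_or_ge n 3 with h | h
  · exact absurd (hS K n hcpt hn ι ρ hirr hins hnl hgeo hreg hlvl (by omega)) hav
  · exact h3 K n hcpt hn ι ρ hirr hins hnl hgeo hreg hlvl h hav

/-- TSR ⟹ TSR≤2 (the birth's existence stub is a restriction of the engine). -/
theorem serreRankTwo_of_reciprocity (hS : TorsionSerreReciprocity) : ∀ (K : Type) [Field K] [NumberField K] (n : ℕ) (hcpt : Literature.NumberTheory.Automorphic.isCompact_glFiniteIntegralLevel n K), 0 < n → ∀ (ι : PadicAlgCl 2 ≃+* ℂ) (ρ : Literature.NumberTheory.GaloisRepresentations.FramedGaloisRep K (PadicAlgCl 2) n), ρ.toGaloisRep.IsIrreducible → (∀ τ : Field.absoluteGaloisGroup K →* GL (Fin n) (Literature.NumberTheory.GaloisRepresentations.padicAlgClResidueField 2), ρ.IsResidualRepOf (RingHom.id (Literature.NumberTheory.GaloisRepresentations.padicAlgClResidueField 2)) τ → ¬ IsSolvable τ.range) → ¬ (∃ (σ : Literature.NumberTheory.GaloisRepresentations.FramedGaloisRep K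 (PadicAlgCl 2) n) (τ : Field.absoluteGaloisGroup K →* GL (Fin n) (Literature.NumberTheory.GaloisRepresentations.padicAlgClResidueField 2)), (Set.range (fun g : Field.absoluteGaloisGroup K => σ g)).Finite ∧ σ.toGaloisRep.IsIrreducible ∧ ρ.IsResidualRepOf (RingHom.id (Literature.NumberTheory.GaloisRepresentations.padicAlgClResidueField 2)) τ ∧ σ.IsResidualRepOf (RingHom.id (Literature.NumberTheory.GaloisRepresentations.padicAlgClResidueField 2)) τ) → ((∀ᶠ v : IsDedekindDomain.HeightOneSpectrum (NumberField.RingOfIntegers K) in cofinite, ρ.IsUnramifiedAt v) ∧ ∀ (v : IsDedekindDomain.HeightOneSpectrum (NumberField.RingOfIntegers K)) (hv : ((2 : ℕ) : NumberField.RingOfIntegers K) ∈ v.asIdeal), (Literature.NumberTheory.PAdicHodge.fontainePstAdicCompletion v 2 hv).IsDeRhamFramed (ρ.toLocal v)) → (∀ (v : IsDedekindDomain.HeightOneSpectrum (NumberField.RingOfIntegers K)) (hv : ((2 : ℕ) : NumberField.RingOfIntegers K) ∈ v.asIdeal), ∀ e : v.adicCompletion K →+* PadicAlgCl 2, Continuous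 e → (ρ.labelledHodgeTateWeightsAt v (Literature.NumberTheory.PAdicHodge.fontainePstAdicCompletion v 2 hv).algebra (Literature.NumberTheory.PAdicHodge.fontainePstAdicCompletion v 2 hv).𝔅 e).Nodup) → (∀ v : IsDedekindDomain.HeightOneSpectrum (NumberField.RingOfIntegers K), ((2 : ℕ) : NumberField.RingOfIntegers K) ∉ v.asIdeal → ρ.IsUnramifiedAt v) → n ≤ 2 → (letI : TopologicalSpace (Literature.NumberTheory.GaloisRepresentations.padicAlgClResidueField 2) := ⊥; ∃ τ : Literature.NumberTheory.GaloisRepresentations.FramedGaloisRep K (Literature.NumberTheory.GaloisRepresentations.padicAlgClResidueField 2) n, ρ.IsReductionOf (RingHom.id (Literature.NumberTheory.GaloisRepresentations.padicAlgClResidueField 2)) (τ : Field.absoluteGaloisGroup K →* GL (Fin n) (Literature.NumberTheory.GaloisRepresentations.padicAlgClResidueField 2)) ∧ (Literature.NumberTheory.Automorphic.BigHeckeGLn.TameLevel.full n K 2).IsPadicallyAutomorphic τ) :=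
  fun K _ _ n hcpt hn ι ρ hirr hins hnl hgeo hreg hlvl _ => hS K n hcpt hn ι ρ hirr hins hnl hgeo hreg hlvl

/-- The two AL birth stubs are S-implied (AL restricted by rank). [kernel certificate] -/
theorem birthStubs_of_langlands (hLg : _root_.Langlands) : (∀ (K : Type) [Field K] [NumberField K] (n : ℕ) (hcpt : Literature.NumberTheory.Automorphic.isCompact_glFiniteIntegralLevel n K), 0 < n → ∀ (ι : PadicAlgCl 2 ≃+* ℂ) (ρ : Literature.NumberTheory.GaloisRepresentations.FramedGaloisRep K (PadicAlgCl 2) n), ρ.toGaloisRep.IsIrreducible → (∀ τ : Field.absoluteGaloisGroup K →* GL (Fin n) (Literature.NumberTheory.GaloisRepresentations.padicAlgClResidueField 2), ρ.IsResidualRepOf (RingHom.id (Literature.NumberTheory.GaloisRepresentations.padicAlgClResidueField 2)) τ → ¬ IsSolvable τ.range) → ¬ (∃ (σ : Literature.NumberTheory.GaloisRepresentations.FramedGaloisRep K (PadicAlgCl 2) n) (τ : Field.absoluteGaloisGroup K →* GL (Fin n) (Literature.NumberTheory.GaloisRepresentations.padicAlgClResidueField 2)), (Set.range (fun g : Field.absoluteGaloisGroup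 K => σ g)).Finite ∧ σ.toGaloisRep.IsIrreducible ∧ ρ.IsResidualRepOf (RingHom.id (Literature.NumberTheory.GaloisRepresentations.padicAlgClResidueField 2)) τ ∧ σ.IsResidualRepOf (RingHom.id (Literature.NumberTheory.GaloisRepresentations.padicAlgClResidueField 2)) τ) → ((∀ᶠ v : IsDedekindDomain.HeightOneSpectrum (NumberField.RingOfIntegers K) in cofinite, ρ.IsUnramifiedAt v) ∧ ∀ (v : IsDedekindDomain.HeightOneSpectrum (NumberField.RingOfIntegers K)) (hv : ((2 : ℕ) : NumberField.RingOfIntegers K) ∈ v.asIdeal), (Literature.NumberTheory.PAdicHodge.fontainePstAdicCompletion v 2 hv).IsDeRhamFramed (ρ.toLocal v)) → (∀ (v : IsDedekindDomain.HeightOneSpectrum (NumberField.RingOfIntegers K)) (hv : ((2 : ℕ) : NumberField.RingOfIntegers K) ∈ v.asIdeal), ∀ e : v.adicCompletion K →+* PadicAlgCl 2, Continuous e → (ρ.labelledHodgeTateWeightsAt v (Literature.NumberTheory.PAdicHodge.fontainePstAdicCompletion v 2 hv).algebra (Literature.NumberTheory.PAdicHodge.fontainePstAdicCompletion v 2 hv).𝔅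 e).Nodup) → (∀ v : IsDedekindDomain.HeightOneSpectrum (NumberField.RingOfIntegers K), ((2 : ℕ) : NumberField.RingOfIntegers K) ∉ v.asIdeal → ρ.IsUnramifiedAt v) → n ≤ 2 → ¬ (letI : TopologicalSpace (Literature.NumberTheory.GaloisRepresentations.padicAlgClResidueField 2) := ⊥; ∃ τ : Literature.NumberTheory.GaloisRepresentations.FramedGaloisRep K (Literature.NumberTheory.GaloisRepresentations.padicAlgClResidueField 2) n, ρ.IsReductionOf (RingHom.id (Literature.NumberTheory.GaloisRepresentations.padicAlgClResidueField 2)) (τ : Field.absoluteGaloisGroup K →* GL (Fin n) (Literature.NumberTheory.GaloisRepresentations.padicAlgClResidueField 2)) ∧ (Literature.NumberTheory.Automorphic.BigHeckeGLn.TameLevel.full n K 2).IsPadicallyAutomorphic τ) → ∃ π : Literature.NumberTheory.Automorphic.CuspidalAutomorphicRepData n K hcpt, π.1.IsLAlgebraic ∧ ∀ᶠ v : IsDedekindDomain.HeightOneSpectrum (NumberField.RingOfIntegers K) in cofinite, ρ.IsUnramifiedAt v ∧ (∃ α : Multiset ℂ, π.1.HasSatakeParamAt v α) ∧ ∀ α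 : Multiset ℂ, π.1.HasSatakeParamAt v α → ∃ P Q : Polynomial (Valued.v : Valuation (PadicAlgCl 2) NNReal).valuationSubring, ρ.HasFrobCharpolyAt v (P.map (Valued.v : Valuation (PadicAlgCl 2) NNReal).valuationSubring.subtype) ∧ Literature.NumberTheory.Automorphic.arithFrobPolyOfSatake ι v.residueCard 1 α = Q.map (Valued.v : Valuation (PadicAlgCl 2) NNReal).valuationSubring.subtype ∧ P.map (IsLocalRing.residue (Valued.v : Valuation (PadicAlgCl 2) NNReal).valuationSubring) = Q.map (IsLocalRing.residue (Valued.v : Valuation (PadicAlgCl 2) NNReal).valuationSubring)) ∧ (∀ (K : Type) [Field K] [NumberField K] (n : ℕ) (hcpt : Literature.NumberTheory.Automorphic.isCompact_glFiniteIntegralLevel n K), 0 < n → ∀ (ι : PadicAlgCl 2 ≃+* ℂ) (ρ : Literature.NumberTheory.GaloisRepresentations.FramedGaloisRep K (PadicAlgCl 2) n), ρ.toGaloisRep.IsIrreducible → (∀ τ : Field.absoluteGaloisGroup K →* GL (Fin n) (Literature.NumberTheory.GaloisRepresentations.padicAlgClResidueField 2), ρ.IsResidualRepOf (RingHom.id (Literature.NumberTheory.GaloisRepresentations.padicAlgClResidueField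 2)) τ → ¬ IsSolvable τ.range) → ¬ (∃ (σ : Literature.NumberTheory.GaloisRepresentations.FramedGaloisRep K (PadicAlgCl 2) n) (τ : Field.absoluteGaloisGroup K →* GL (Fin n) (Literature.NumberTheory.GaloisRepresentations.padicAlgClResidueField 2)), (Set.range (fun g : Field.absoluteGaloisGroup K => σ g)).Finite ∧ σ.toGaloisRep.IsIrreducible ∧ ρ.IsResidualRepOf (RingHom.id (Literature.NumberTheory.GaloisRepresentations.padicAlgClResidueField 2)) τ ∧ σ.IsResidualRepOf (RingHom.id (Literature.NumberTheory.GaloisRepresentations.padicAlgClResidueField 2)) τ) → ((∀ᶠ v : IsDedekindDomain.HeightOneSpectrum (NumberField.RingOfIntegers K) in cofinite, ρ.IsUnramifiedAt v) ∧ ∀ (v : IsDedekindDomain.HeightOneSpectrum (NumberField.RingOfIntegers K)) (hv : ((2 : ℕ) : NumberField.RingOfIntegers K) ∈ v.asIdeal), (Literature.NumberTheory.PAdicHodge.fontainePstAdicCompletion v 2 hv).IsDeRhamFramed (ρ.toLocal v)) → (∀ (v : IsDedekindDomain.HeightOneSpectrum (NumberField.RingOfIntegers K)) (hv : ((2 :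 ℕ) : NumberField.RingOfIntegers K) ∈ v.asIdeal), ∀ e : v.adicCompletion K →+* PadicAlgCl 2, Continuous e → (ρ.labelledHodgeTateWeightsAt v (Literature.NumberTheory.PAdicHodge.fontainePstAdicCompletion v 2 hv).algebra (Literature.NumberTheory.PAdicHodge.fontainePstAdicCompletion v 2 hv).𝔅 e).Nodup) → (∀ v : IsDedekindDomain.HeightOneSpectrum (NumberField.RingOfIntegers K), ((2 : ℕ) : NumberField.RingOfIntegers K) ∉ v.asIdeal → ρ.IsUnramifiedAt v) → 3 ≤ n → ¬ (letI : TopologicalSpace (Literature.NumberTheory.GaloisRepresentations.padicAlgClResidueField 2) := ⊥; ∃ τ : Literature.NumberTheory.GaloisRepresentations.FramedGaloisRep K (Literature.NumberTheory.GaloisRepresentations.padicAlgClResidueField 2) n, ρ.IsReductionOf (RingHom.id (Literature.NumberTheory.GaloisRepresentations.padicAlgClResidueField 2)) (τ : Field.absoluteGaloisGroup K →* GL (Fin n) (Literature.NumberTheory.GaloisRepresentations.padicAlgClResidueField 2)) ∧ (Literature.NumberTheory.Automorphic.BigHeckeGLn.TameLevel.full n K 2).IsPadicallyAutomorphic τ)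 → ∃ π : Literature.NumberTheory.Automorphic.CuspidalAutomorphicRepData n K hcpt, π.1.IsLAlgebraic ∧ ∀ᶠ v : IsDedekindDomain.HeightOneSpectrum (NumberField.RingOfIntegers K) in cofinite, ρ.IsUnramifiedAt v ∧ (∃ α : Multiset ℂ, π.1.HasSatakeParamAt v α) ∧ ∀ α : Multiset ℂ, π.1.HasSatakeParamAt v α → ∃ P Q : Polynomial (Valued.v : Valuation (PadicAlgCl 2) NNReal).valuationSubring, ρ.HasFrobCharpolyAt v (P.map (Valued.v : Valuation (PadicAlgCl 2) NNReal).valuationSubring.subtype) ∧ Literature.NumberTheory.Automorphic.arithFrobPolyOfSatake ι v.residueCard 1 α = Q.map (Valued.v : Valuation (PadicAlgCl 2) NNReal).valuationSubring.subtype ∧ P.map (IsLocalRing.residue (Valued.v : Valuation (PadicAlgCl 2) NNReal).valuationSubring) = Q.map (IsLocalRing.residue (Valued.v : Valuation (PadicAlgCl 2) NNReal).valuationSubring)) :=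
  ⟨fun K _ _ n hcpt hn ι ρ hirr hins hnl hgeo hreg hlvl _ hav => avatarless_of_langlands hLg K n hcpt hn ι ρ hirr hins hnl hgeo hreg hlvl hav,
   fun K _ _ n hcpt hn ι ρ hirr hins hnl hgeo hreg hlvl _ hav => avatarless_of_langlands hLg K n hcpt hn ι ρ hirr hins hnl hgeo hreg hlvl hav⟩

/-- The BC5 rung of TA (plan-only stub `stub_rung_totallyRealRankTwoTorsion`: totally real K, rank 2 — the defect-zero sector) is an instance of TA,
hence S-implied. [kernel certificate] -/
theorem rung_of_torsionAvatar (hT : TorsionAvatarAutomorphy) : ∀ (K : Type) [Field K] [NumberField K] [NumberField.IsTotallyReal K] (hcpt : Literature.NumberTheory.Automorphic.isCompact_glFiniteIntegralLevel 2 K) (ι : PadicAlgCl 2 ≃+* ℂ) (ρ : Literature.NumberTheory.GaloisRepresentations.FramedGaloisRep K (PadicAlgCl 2) 2), ρ.toGaloisRep.IsIrreducible → (∀ τ : Field.absoluteGaloisGroup K →* GL (Fin 2) (Literature.NumberTheory.GaloisRepresentations.padicAlgClResidueField 2), ρ.IsResidualRepOf (RingHom.id (Literature.NumberTheory.GaloisRepresentations.padicAlgClResidueField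 2)) τ → ¬ IsSolvable τ.range) → ¬ (∃ (σ : Literature.NumberTheory.GaloisRepresentations.FramedGaloisRep K (PadicAlgCl 2) 2) (τ : Field.absoluteGaloisGroup K →* GL (Fin 2) (Literature.NumberTheory.GaloisRepresentations.padicAlgClResidueField 2)), (Set.range (fun g : Field.absoluteGaloisGroup K => σ g)).Finite ∧ σ.toGaloisRep.IsIrreducible ∧ ρ.IsResidualRepOf (RingHom.id (Literature.NumberTheory.GaloisRepresentations.padicAlgClResidueField 2)) τ ∧ σ.IsResidualRepOf (RingHom.id (Literature.NumberTheory.GaloisRepresentations.padicAlgClResidueField 2)) τ) → ((∀ᶠ v : IsDedekindDomain.HeightOneSpectrum (NumberField.RingOfIntegers K) in cofinite, ρ.IsUnramifiedAt v) ∧ ∀ (v : IsDedekindDomain.HeightOneSpectrum (NumberField.RingOfIntegers K)) (hv : ((2 : ℕ) : NumberField.RingOfIntegers K) ∈ v.asIdeal), (Literature.NumberTheory.PAdicHodge.fontainePstAdicCompletion v 2 hv).IsDeRhamFramed (ρ.toLocal v)) → (∀ (v : IsDedekindDomain.HeightOneSpectrum (NumberField.RingOfIntegers K)) (hv : ((2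 : ℕ) : NumberField.RingOfIntegers K) ∈ v.asIdeal), ∀ e : v.adicCompletion K →+* PadicAlgCl 2, Continuous e → (ρ.labelledHodgeTateWeightsAt v (Literature.NumberTheory.PAdicHodge.fontainePstAdicCompletion v 2 hv).algebra (Literature.NumberTheory.PAdicHodge.fontainePstAdicCompletion v 2 hv).𝔅 e).Nodup) → (∀ v : IsDedekindDomain.HeightOneSpectrum (NumberField.RingOfIntegers K), ((2 : ℕ) : NumberField.RingOfIntegers K) ∉ v.asIdeal → ρ.IsUnramifiedAt v) → (letI : TopologicalSpace (Literature.NumberTheory.GaloisRepresentations.padicAlgClResidueField 2) := ⊥; ∃ τ : Literature.NumberTheory.GaloisRepresentations.FramedGaloisRep K (Literature.NumberTheory.GaloisRepresentations.padicAlgClResidueField 2) 2, ρ.IsReductionOf (RingHom.id (Literature.NumberTheory.GaloisRepresentations.padicAlgClResidueField 2)) (τ : Field.absoluteGaloisGroup K →* GL (Fin 2) (Literature.NumberTheory.GaloisRepresentations.padicAlgClResidueField 2)) ∧ (Literature.NumberTheory.Automorphic.BigHeckeGLn.TameLevel.full 2 K 2).IsPadicallyAutomorphic τ) → ∃ π :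 Literature.NumberTheory.Automorphic.CuspidalAutomorphicRepData 2 K hcpt, π.1.IsLAlgebraic ∧ ∀ᶠ v : IsDedekindDomain.HeightOneSpectrum (NumberField.RingOfIntegers K) in cofinite, ρ.IsUnramifiedAt v ∧ (∃ α : Multiset ℂ, π.1.HasSatakeParamAt v α) ∧ ∀ α : Multiset ℂ, π.1.HasSatakeParamAt v α → ∃ P Q : Polynomial (Valued.v : Valuation (PadicAlgCl 2) NNReal).valuationSubring, ρ.HasFrobCharpolyAt v (P.map (Valued.v : Valuation (PadicAlgCl 2) NNReal).valuationSubring.subtype) ∧ Literature.NumberTheory.Automorphic.arithFrobPolyOfSatake ι v.residueCard 1 α = Q.map (Valued.v : Valuation (PadicAlgCl 2) NNReal).valuationSubring.subtype ∧ P.map (IsLocalRing.residue (Valued.v : Valuation (PadicAlgCl 2) NNReal).valuationSubring) = Q.map (IsLocalRing.residue (Valued.v : Valuation (PadicAlgCl 2) NNReal).valuationSubring) :=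
  fun K _ _ _ hcpt ι ρ hirr hins hnl hgeo hreg hlvl hav => hT K 2 hcpt two_pos ι ρ hirr hins hnl hgeo hreg hlvl hav

/-! ## KERNEL V — the deciding theorems -/

/-- `closes` of the child route `TorsionAvatarReduction` (three binders: TA → AL → FRAME⁗ → Langlands). -/
theorem closes_framed (hT : TorsionAvatarAutomorphy) (hA : AvatarlessResidueAutomorphy) (hF : RegularResidueFrame) : _root_.Langlands :=
  hF (regular_of_cells hT hA)

/-- `closes` over the PARENT route's binders: REG replaced by its two cells (four binders TA → AL → NRA → FRAME‴ → Langlands). -/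
theorem closes (hT : TorsionAvatarAutomorphy) (hA : AvatarlessResidueAutomorphy) (hN : RegularAvatarReduction.NoRegularAvatarAutomorphy)
    (hF : RegularAvatarReduction.NonLiftableResidueFrame) : _root_.Langlands :=
  RegularAvatarReduction.closes (regular_of_cells hT hA) hN hF

/-- `closes` over the GRAND-HOST route-Langlands-NonLiftableResidueReduction rev 0 (five binders; NLR = REG ∧ NRA = (TA ∧ AL) ∧ NRA). -/
theorem closes_host (hL : NonLiftableResidueReduction.LiftableResidueAutomorphy) (hT : TorsionAvatarAutomorphy) (hA : AvatarlessResidueAutomorphy)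
    (hN : RegularAvatarReduction.NoRegularAvatarAutomorphy) (hF : NonLiftableResidueReduction.InsolubleResidueFrame) : _root_.Langlands :=
  Regular.closes hL (regularNonLiftableAutomorphy_route_iff_twin.mp (regular_of_cells hT hA)) (noRegularAvatarAutomorphy_route_iff_twin.mp hN) hF

/-- `closes` over the GREAT-GRAND-HOST route-Langlands-InsolubleResidueReduction rev 0 (seven binders; INS = LART ∧ TA ∧ AL ∧ NRA). -/
theorem closes_grandhost (hAB : InsolubleResidueReduction.AbelianResidueAutomorphy) (hSOL : InsolubleResidueReduction.SolubleResidueAutomorphy)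
    (hL : Liftable.LiftableResidueAutomorphy) (hT : TorsionAvatarAutomorphy) (hA : AvatarlessResidueAutomorphy)
    (hN : RegularAvatarReduction.NoRegularAvatarAutomorphy) (hF : InsolubleResidueReduction.DyadicLevelOneFrame) : _root_.Langlands :=
  Regular.closes_host hAB hSOL hL (regularNonLiftableAutomorphy_route_iff_twin.mp (regular_of_cells hT hA))
    (noRegularAvatarAutomorphy_route_iff_twin.mp hN) hF

/-- The MinimalLevelDescent aside rung 27525 (B₂ over ℚ in rank 2) follows from AB ∧ SOL ∧ LART ∧ TA ∧ AL ∧ NRA. -/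
theorem rung_of_cells (hAB : Residue.AbelianResidueAutomorphy) (hSOL : Residue.SolubleResidueAutomorphy)
    (hL : Liftable.LiftableResidueAutomorphy) (hT : TorsionAvatarAutomorphy) (hA : AvatarlessResidueAutomorphy)
    (hN : RegularAvatarReduction.NoRegularAvatarAutomorphy) : MinimalLevelDescent.DyadicLevelOneRankTwoQ :=
  Regular.rung_of_cells hAB hSOL hL (regularNonLiftableAutomorphy_route_iff_twin.mp (regular_of_cells hT hA))
    (noRegularAvatarAutomorphy_route_iff_twin.mp hN)

end Summit.Langlands.Langlands.Theorems.LevelOneDyadic.Torsion
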